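import Mathlib.Analysis.SpecialFunctions.Exponential
import Mathlib.Analysis.Matrix.Normed
import Mathlib.Analysis.Complex.RealDeriv
import Mathlib.Analysis.Calculus.Deriv.Mul
import Mathlib.Analysis.Calculus.Deriv.Comp
import Mathlib.Analysis.Calculus.Deriv.Shift
import Mathlib.Analysis.Calculus.FDeriv.Mul
import Mathlib.Analysis.Calculus.LineDeriv.Measurable
import Mathlib.Analysis.Calculus.LineDeriv.IntegrationByParts
import Mathlib.Analysis.Calculus.MeanValue
import Mathlib.Analysis.Calculus.ContDiff.Bounds
import Mathlib.Analysis.Calculus.ParametricIntegral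
import Mathlib.MeasureTheory.Integral.IntervalIntegral.FundThmCalculus
import Mathlib.Analysis.CStarAlgebra.Matrix
import Mathlib.Analysis.Fourier.FourierTransformDeriv
import Mathlib.Analysis.SpecialFunctions.JapaneseBracket
import Literature.Analysis.Fourier.LpMultiplier
import Literature.Analysis.Fourier.ParametricFourierSlices
import HarnessLib

/-!
# Paley–Wiener by complex deformation: finite propagation for Fourier multipliers whose
symbols are exponentials of linear matrix pencils

Let `V` be a finite-dimensional real inner product space, `L : V →L[ℝ] Matrix (Fin k) (Fin k) ℂ`
a real-linear matrix pencil and `M(ξ) = exp(Lξ)`. The multiplier operator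
`M(D)ψ = 𝓕⁻¹[M 𝓕ψ]` (`Literature.Analysis.Fourier.multiplierOp`, Mathlib's normalisation
`𝓕f(ξ) = ∫ e^{-2πi⟨x,ξ⟩} f(x) dx`) is the time-one solution operator of the constant-coefficient
system `∂ₜŵ = L(ξ)ŵ`. This file proves the classical **finite speed of propagation by the
Paley–Wiener argument**: if the symbol extends to complex frequencies with exponential type,

  `|exp(Lξ + ib Lν)ᵢⱼ| ≤ C e^{γ|b|}`  for all `ξ ∈ V`, `‖ν‖ ≤ 1`, `b ∈ ℝ`  (`HasExpType L C γ`),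

then for every `ψ ∈ C_c^∞(V; ℂᵏ)` supported in the closed ball `B̄(x₀, r)`,

  `M(D)ψ(x) = 0` whenever `‖x - x₀‖ > r + γ/(2π)`

(`multiplierOp_exp_apply_eq_zero`, centre `0`; `multiplierOp_exp_apply_eq_zero_of_dist`, general
centre). This is the multiplier form of the textbook proof of finite propagation speed for
constant-coefficient hyperbolic systems via the Paley–Wiener(–Schwartz) theorem
[Hörmander, ALPDO I, Thm 7.3.1; II, §12.5], [Rauch1986, Proof of Theorem p. 482: "the finite speed
of propagation for (1)"], here for the linearised constant-coefficient system, which is the case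
consumed by `Literature/Barriers/AtomisticToContinuum/NoBVEstimatesMultiDFinitePropagationConstant.lean`.

## The proof (no contour integrals)

Fix `x` with `‖x‖ > ρ + γ/(2π)` (`supp ψ ⊆ B̄(0, ρ)`) and the unit direction `ν = x/‖x‖`. For
`b ∈ ℝ` put `ψ_b = e^{2πb⟨·,ν⟩}ψ` (`deform`), so that `𝓕ψ_b(ξ) = "𝓕ψ(ξ + ibν)"`, and

  `J(b) = ∫ E_b(ξ) M_b(ξ) 𝓕ψ_b(ξ) dξ`,  `E_b(ξ) = e^{2πi⟨ξ,x⟩} e^{-2πb⟨x,ν⟩}`,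
  `M_b(ξ) = exp(Lξ + ib Lν)`  (`defPhi`, `defJ`).

Then `J(0) = M(D)ψ(x)`. Each factor satisfies the Cauchy–Riemann relation `∂_b = i ∂_ν` (`∂_ν`
the directional derivative in `ξ`): for `E_b` explicitly (`phaseE_cr`), for `M_b` by holomorphy of
`w ↦ exp(X + wY)` (`hasDerivAt_symM_param`, `hasDerivAt_symM_line`), for `𝓕ψ_b` by
differentiating under the integral sign (`hasDerivAt_fourier_deform_param`,
`hasDerivAt_fourier_line`, `fourier_deform_innerWeight_eq`). Hence `∂_bΦ_b = i ∂_νΦ_b`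
(`defPhiDb_eq`) and, differentiating under the integral sign (dominated by
`K_β (1 + ‖ξ‖^{dim V + 1})⁻¹`, `norm_defPhi_le`) and integrating by parts in `ξ` along `ν`
(Mathlib's `integral_bilinear_hasLineDerivAt_right_eq_neg_left_of_integrable` against the constant
`1`), `J'(b) = i ∫ ∂_νΦ_b = 0`: `J` is constant (`defJ_eq_defJ_zero`). Finally
`‖J(b)‖ ≤ e^{-2πb‖x‖} · kC e^{γb} · c_V (1 + 2πb)^{dim V+1} e^{2πρ b} Σ_{j ≤ dim V+1} ‖Dʲψ‖_{L¹}`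
(`norm_defJ_le`, from the Schwartz-type decay of `𝓕ψ_b`, `norm_fourier_deform_le`, Mathlib's
`VectorFourier.pow_mul_norm_iteratedFDeriv_fourierIntegral_le`), which tends to `0` as
`b → +∞` because `2π‖x‖ > γ + 2πρ` (`tendsto_pow_mul_exp_neg_mul`). So `M(D)ψ(x) = J(0) = 0`.

The derivative bound for the deformed symbol, `‖∂_ν M_b(ξ)‖ ≤ (kC e^{γ(|b|+1)})² ‖Lν‖`
uniformly in `ξ` (`HasExpType.norm_symD_le`), comes from Duhamel's formula
`e^Z - e^X = ∫₀¹ e^{(1-θ)X}(Z - X)e^{θZ} dθ` (`exp_sub_exp_eq_integral`,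
`norm_deriv_exp_add_smul_le`) and the fact that the family of deformed symbols is closed under
the scalings `θ ∈ [0, 1]` (`smul_line_eq`).

## Contents

* Part A — calculus of `w ↦ exp(X + wY)` in `Matrix (Fin k) (Fin k) ℂ` (operator norm
  `Matrix.linftyOp…`): holomorphy, Cauchy–Riemann along real and imaginary directions, Duhamel.
* Part B — the deformed test functions `ψ_b = e^{2πb⟨·,ν⟩}ψ`: Leibniz bounds for
  `‖Dⁿψ_b‖`, decay of `𝓕ψ_b`, and the derivatives of `𝓕ψ_b(ξ)` in `ξ` (along `ν`) and in `b`.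
* Part C — the deformed symbol `symM L ν b ξ = exp(Lξ + ib Lν)`, the exponential-type
  hypothesis `HasExpType`, the phase `phaseE`, the integrand `defPhi` with its two derivatives
  and the majorants, `defJ`, and the two theorems above; translation covariance of `M(D)`
  (`multiplierOp_comp_add_right`).

## References

* [Rauch1986] J. Rauch, Comm. Math. Phys. 106 (1986) 481–484, Proof of Theorem p. 482 ("the
  finite speed of propagation for (1)").
* [HormanderALPDO1] L. Hörmander, The Analysis of Linear Partial Differential Operators I,
  Thm 7.3.1 (Paley–Wiener–Schwartz); the deformation-of-contour proof of finite propagation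
  speed for constant-coefficient hyperbolic operators is [ALPDO II, Thm 12.5.1]. The present
  `b`-deformation form (an ODE in the deformation parameter instead of a contour shift) is
  folklore.
-/

noncomputable section

open Set Filter Topology MeasureTheory Real Metric Complex Matrix
open scoped FourierTransform RealInnerProductSpace ContDiff Matrix.Norms.Operator

namespace Literature.Analysis.Fourier

/-! ## Part A: calculus of the matrix exponential along complex lines -/

section PartA

open intervalIntegral

variable {k : ℕ}

local notation "𝕄" => Matrix (Fin k) (Fin k) ℂ

/-! ### Holomorphy of `w ↦ exp(X + wY)` and the Cauchy–Riemann relations along a line -/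

/-- `w ↦ exp(X + w • Y)` is complex-differentiable (the exponential series has infinite radius).
[folklore] -/
theorem differentiable_exp_add_smul (X Y : 𝕄) :
    Differentiable ℂ fun w : ℂ => NormedSpace.exp (X + w • Y) := by
  intro w
  have hexp : AnalyticAt ℂ (NormedSpace.exp (𝔸 := Matrix (Fin k) (Fin k) ℂ)) (X + w • Y) :=
    NormedSpace.analyticAt_exp_of_mem_ball (𝕂 := ℂ) _ (by
      rw [NormedSpace.expSeries_radius_eq_top]; exact Metric.mem_eball.2 (by simp))
  exact hexp.differentiableAt.comp w
    ((DifferentiableAt.smul_const differentiableAt_id Y).const_add X)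

/-- Derivative of a complex-differentiable vector-valued map along a real-parametrised affine
curve `s ↦ w₀ + s c`: it is `c • F'`. [folklore] -/
theorem hasDerivAt_comp_real_affine {E : Type*} [NormedAddCommGroup E] [NormedSpace ℂ E]
    {F : ℂ → E} {F' : E} (w₀ c : ℂ) (s₀ : ℝ) (hF : HasDerivAt F F' (w₀ + (s₀ : ℂ) * c)) :
    HasDerivAt (fun s : ℝ => F (w₀ + (s : ℂ) * c)) (c • F') s₀ := by
  have hγ : HasDerivAt (fun s : ℝ => w₀ + (s : ℂ) * c) c s₀ := by
    have h1 : HasDerivAt (fun s : ℝ => (s : ℂ) * c) (1 * c) s₀ :=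
      HasDerivAt.mul_const (Complex.ofRealCLM.hasDerivAt (x := s₀)) c
    simpa using h1.const_add w₀
  have h := (hF.hasFDerivAt.restrictScalars ℝ).comp_hasDerivAt s₀ hγ
  simpa [Function.comp_def] using h

/-- Real direction: `s ↦ exp(X + (w₀ + s) • Y)` has derivative `F'(w₀ + s₀)`. [folklore] -/
theorem hasDerivAt_exp_add_smul_real (X Y : 𝕄) (w₀ : ℂ) (s₀ : ℝ) :
    HasDerivAt (fun s : ℝ => NormedSpace.exp (X + (w₀ + (s : ℂ)) • Y))
      (deriv (fun w : ℂ => NormedSpace.exp (X + w • Y)) (w₀ + s₀)) s₀ := by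
  have hF := (differentiable_exp_add_smul X Y (w₀ + (s₀ : ℂ) * 1)).hasDerivAt
  have h := hasDerivAt_comp_real_affine w₀ 1 s₀ hF
  simp only [mul_one, one_smul] at h
  exact h

/-- Imaginary direction: `b ↦ exp(X + (w₀ + bi) • Y)` has derivative `i F'(w₀ + b₀i)`
(Cauchy–Riemann). [folklore] -/
theorem hasDerivAt_exp_add_smul_imag (X Y : 𝕄) (w₀ : ℂ) (b₀ : ℝ) :
    HasDerivAt (fun b : ℝ => NormedSpace.exp (X + (w₀ + (b : ℂ) * Complex.I) • Y))
      (Complex.I • deriv (fun w : ℂ => NormedSpace.exp (X + w • Y)) (w₀ + b₀ * Complex.I)) b₀ := by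
  have hF := (differentiable_exp_add_smul X Y (w₀ + (b₀ : ℂ) * Complex.I)).hasDerivAt
  exact hasDerivAt_comp_real_affine w₀ Complex.I b₀ hF

/-! ### The Duhamel identity and the derivative bound -/

/-- The algebra of Duhamel's integrand: `-(aX)c + a(Zc) = a(Z - X)c`. [folklore] -/
private theorem duhamel_algebra (a c X Z : 𝕄) :
    -(a * X) * c + a * (Z * c) = a * (Z - X) * c := by noncomm_ring

/-- **Duhamel's identity**: `exp Z - exp X = ∫₀¹ exp((1-θ)X) (Z - X) exp(θZ) dθ`. [folklore] -/
theorem exp_sub_exp_eq_integral (X Z : 𝕄) :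
    NormedSpace.exp Z - NormedSpace.exp X =
      ∫ θ in (0 : ℝ)..1, NormedSpace.exp ((1 - θ) • X) * (Z - X) * NormedSpace.exp (θ • Z) := by
  -- `U(θ) = exp((1-θ)X) exp(θZ)`, `U' = exp((1-θ)X)(Z - X)exp(θZ)`
  set U : ℝ → 𝕄 := fun θ =>
    NormedSpace.exp ((1 - θ) • X) * NormedSpace.exp (θ • Z) with hU
  have hU' : ∀ θ, HasDerivAt U
      (NormedSpace.exp ((1 - θ) • X) * (Z - X) * NormedSpace.exp (θ • Z)) θ := by
    intro θ
    have h1 := HasDerivAt.comp_const_sub 1 θ (hasDerivAt_exp_smul_const (𝕂 := ℝ) X (1 - θ))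
    have h2 := hasDerivAt_exp_smul_const' (𝕂 := ℝ) Z θ
    have h := HasDerivAt.mul h1 h2
    refine h.congr_deriv ?_
    exact duhamel_algebra _ _ X Z
  have hcont : Continuous fun θ : ℝ =>
      NormedSpace.exp ((1 - θ) • X) * (Z - X) * NormedSpace.exp (θ • Z) := by
    refine ((NormedSpace.exp_continuous.comp ((continuous_const.sub continuous_id).smul
      continuous_const)).mul continuous_const).mul
      (NormedSpace.exp_continuous.comp (continuous_id.smul continuous_const))
  have hFTC := integral_eq_sub_of_hasDerivAt (a := (0 : ℝ)) (b := 1) (fun θ _ => hU' θ)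
    (hcont.intervalIntegrable 0 1)
  rw [hFTC]
  simp [hU]

/-- **Norm bound for the complex derivative of `w ↦ exp(W + wY)` at `0`** from uniform bounds
on the exponentials `exp(θ(W + sY))`, `θ ∈ [0,1]`, `s ∈ [0,1]`: `‖F'(0)‖ ≤ B² ‖Y‖`.
[folklore] -/
theorem norm_deriv_exp_add_smul_le (W Y : 𝕄) {B : ℝ} (hB : 0 ≤ B)
    (h : ∀ θ ∈ Icc (0 : ℝ) 1, ∀ s ∈ Icc (0 : ℝ) 1,
      ‖NormedSpace.exp (θ • (W + (s : ℂ) • Y))‖ ≤ B) :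
    ‖deriv (fun w : ℂ => NormedSpace.exp (W + w • Y)) 0‖ ≤ B ^ 2 * ‖Y‖ := by
  -- the real-direction derivative at `0` is the limit of difference quotients
  have hd := hasDerivAt_exp_add_smul_real W Y 0 0
  simp only [zero_add, Complex.ofReal_zero] at hd
  -- difference quotient bound from Duhamel
  have hquot : ∀ s ∈ Ioc (0 : ℝ) 1,
      ‖(s⁻¹ : ℝ) • (NormedSpace.exp (W + (s : ℂ) • Y) - NormedSpace.exp (W + ((0 : ℝ) : ℂ) • Y))‖ ≤
        B ^ 2 * ‖Y‖ := by
    intro s hs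
    rw [Complex.ofReal_zero, zero_smul, add_zero, exp_sub_exp_eq_integral]
    have hsub : W + (s : ℂ) • Y - W = (s : ℂ) • Y := by abel
    rw [hsub, norm_smul, Real.norm_eq_abs, abs_inv, abs_of_pos hs.1]
    have hbound : ‖∫ θ in (0 : ℝ)..1, NormedSpace.exp ((1 - θ) • W) * ((s : ℂ) • Y) *
        NormedSpace.exp (θ • (W + (s : ℂ) • Y))‖ ≤ s * (B ^ 2 * ‖Y‖) * |1 - 0| := by
      refine norm_integral_le_of_norm_le_const fun θ hθ => ?_
      rw [uIoc_of_le zero_le_one] at hθ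
      have hθ' : θ ∈ Icc (0 : ℝ) 1 := ⟨hθ.1.le, hθ.2⟩
      have h1θ : 1 - θ ∈ Icc (0 : ℝ) 1 := ⟨by linarith [hθ.2], by linarith [hθ.1]⟩
      have e1 : ‖NormedSpace.exp ((1 - θ) • W)‖ ≤ B := by
        have := h (1 - θ) h1θ 0 ⟨le_rfl, zero_le_one⟩
        simpa using this
      have e2 : ‖NormedSpace.exp (θ • (W + (s : ℂ) • Y))‖ ≤ B := h θ hθ' s ⟨hs.1.le, hs.2⟩
      calc ‖NormedSpace.exp ((1 - θ) • W) * ((s : ℂ) • Y) * NormedSpace.exp (θ • (W + (s : ℂ) • Y))‖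
          ≤ ‖NormedSpace.exp ((1 - θ) • W)‖ * ‖(s : ℂ) • Y‖ *
              ‖NormedSpace.exp (θ • (W + (s : ℂ) • Y))‖ :=
            (norm_mul_le _ _).trans (mul_le_mul_of_nonneg_right (norm_mul_le _ _) (norm_nonneg _))
        _ ≤ B * (s * ‖Y‖) * B := by
            rw [norm_smul, Complex.norm_real, Real.norm_eq_abs, abs_of_pos hs.1]
            have hsY : 0 ≤ s * ‖Y‖ := mul_nonneg hs.1.le (norm_nonneg _)
            exact mul_le_mul (mul_le_mul e1 le_rfl hsY hB) e2 (norm_nonneg _) (mul_nonneg hB hsY)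
        _ = s * (B ^ 2 * ‖Y‖) := by ring
    calc s⁻¹ * ‖∫ θ in (0 : ℝ)..1, NormedSpace.exp ((1 - θ) • W) * ((s : ℂ) • Y) *
          NormedSpace.exp (θ • (W + (s : ℂ) • Y))‖
        ≤ s⁻¹ * (s * (B ^ 2 * ‖Y‖) * |1 - 0|) :=
          mul_le_mul_of_nonneg_left hbound (inv_nonneg.2 hs.1.le)
      _ = B ^ 2 * ‖Y‖ := by rw [sub_zero, abs_one, mul_one, ← mul_assoc, inv_mul_cancel₀ hs.1.ne', one_mul]
  -- pass to the limit `s → 0⁺`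
  have htend := hd.tendsto_slope_zero_right
  refine le_of_tendsto (htend.norm) ?_
  rw [eventually_nhdsWithin_iff]
  filter_upwards [Ioo_mem_nhds (show (-1 : ℝ) < 0 by norm_num) (show (0 : ℝ) < 1 by norm_num)]
    with s hs hs0
  simpa only [zero_add] using hquot s ⟨hs0, hs.2.le⟩

end PartA

/-! ## Part B: deformed test functions and their Fourier transforms -/

section PartB

variable {V : Type*} [NormedAddCommGroup V] [InnerProductSpace ℝ V] [FiniteDimensional ℝ V]
  [MeasurableSpace V] [BorelSpace V]
  {E : Type*} [NormedAddCommGroup E] [NormedSpace ℂ E]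

/-! ### The exponential weight `e_b(y) = exp(2π b ⟪y, ν⟫)` -/

/-- The exponential weight `e_b(y) = exp(2πb⟪y, ν⟫)`. [folklore] -/
def expWeight (ν : V) (b : ℝ) (y : V) : ℝ := Real.exp (2 * π * b * ⟪y, ν⟫)

omit [FiniteDimensional ℝ V] [MeasurableSpace V] [BorelSpace V] in
/-- `e_b > 0`. [folklore] -/
theorem expWeight_pos (ν : V) (b : ℝ) (y : V) : 0 < expWeight ν b y := Real.exp_pos _

omit [FiniteDimensional ℝ V] [MeasurableSpace V] [BorelSpace V] in
/-- `e_0 = 1`. [folklore] -/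
theorem expWeight_zero (ν : V) (y : V) : expWeight ν 0 y = 1 := by simp [expWeight]

omit [FiniteDimensional ℝ V] [MeasurableSpace V] [BorelSpace V] in
/-- `e_b = (s ↦ exp(2πb s)) ∘ ⟪ν, ·⟫`. [folklore] -/
theorem expWeight_eq_comp (ν : V) (b : ℝ) :
    expWeight ν b = (fun s : ℝ => Real.exp (2 * π * b * s)) ∘ (innerSL ℝ ν) := by
  funext y
  simp [expWeight, real_inner_comm]

omit [FiniteDimensional ℝ V] [MeasurableSpace V] [BorelSpace V] in
/-- `e_b` is smooth. [folklore] -/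
theorem contDiff_expWeight (ν : V) (b : ℝ) {n : WithTop ℕ∞} : ContDiff ℝ n (expWeight ν b) := by
  rw [expWeight_eq_comp]
  exact (Real.contDiff_exp.comp (contDiff_const.mul contDiff_id)).comp (innerSL ℝ ν).contDiff

omit [FiniteDimensional ℝ V] [MeasurableSpace V] [BorelSpace V] in
/-- `e_b(y) ≤ exp(2π ρ |b|)` when `‖y‖ ≤ ρ` and `‖ν‖ ≤ 1`. [folklore] -/
theorem expWeight_le {ν : V} (hν : ‖ν‖ ≤ 1) (b : ℝ) {ρ : ℝ} {y : V} (hy : ‖y‖ ≤ ρ) :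
    expWeight ν b y ≤ Real.exp (2 * π * ρ * |b|) := by
  unfold expWeight
  refine Real.exp_le_exp.2 ?_
  have hρ : 0 ≤ ρ := (norm_nonneg _).trans hy
  have h1 : |⟪y, ν⟫| ≤ ρ := by
    calc |⟪y, ν⟫| ≤ ‖y‖ * ‖ν‖ := abs_real_inner_le_norm y ν
      _ ≤ ρ * 1 := mul_le_mul hy hν (norm_nonneg _) hρ
      _ = ρ := mul_one ρ
  have h2 : b * ⟪y, ν⟫ ≤ |b| * ρ := by
    calc b * ⟪y, ν⟫ ≤ |b * ⟪y, ν⟫| := le_abs_self _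
      _ = |b| * |⟪y, ν⟫| := abs_mul _ _
      _ ≤ |b| * ρ := mul_le_mul_of_nonneg_left h1 (abs_nonneg b)
  nlinarith [Real.pi_pos]

omit [FiniteDimensional ℝ V] [MeasurableSpace V] [BorelSpace V] in
/-- **`‖Dⁱ e_b(y)‖ ≤ (2π|b|)ⁱ e_b(y)`** for `‖ν‖ ≤ 1`. [folklore] -/
theorem norm_iteratedFDeriv_expWeight_le {ν : V} (hν : ‖ν‖ ≤ 1) (b : ℝ) (i : ℕ) (y : V) :
    ‖iteratedFDeriv ℝ i (expWeight ν b) y‖ ≤ (2 * π * |b|) ^ i * expWeight ν b y := by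
  have hfun := expWeight_eq_comp ν b
  have hf : ContDiff ℝ i (fun s : ℝ => Real.exp (2 * π * b * s)) :=
    Real.contDiff_exp.comp (contDiff_const.mul contDiff_id)
  rw [hfun, ContinuousLinearMap.iteratedFDeriv_comp_right (innerSL ℝ ν) hf y le_rfl]
  refine (ContinuousMultilinearMap.norm_compContinuousLinearMap_le _ _).trans ?_
  rw [Finset.prod_const, Finset.card_univ, Fintype.card_fin, norm_iteratedFDeriv_eq_norm_iteratedDeriv,
    iteratedDeriv_exp_const_mul, innerSL_apply_norm]
  have hexp : Real.exp (2 * π * b * (innerSL ℝ ν) y) = expWeight ν b y := by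
    simp [expWeight, real_inner_comm]
  rw [Real.norm_eq_abs, abs_mul, abs_of_pos (Real.exp_pos _), hexp, abs_pow,
    show |2 * π * b| = 2 * π * |b| by rw [abs_mul, abs_of_pos Real.two_pi_pos]]
  calc (2 * π * |b|) ^ i * expWeight ν b y * ‖ν‖ ^ i
      ≤ (2 * π * |b|) ^ i * expWeight ν b y * 1 := by
        refine mul_le_mul_of_nonneg_left (pow_le_one₀ (norm_nonneg _) hν) ?_
        exact mul_nonneg (by positivity) (expWeight_pos ν b y).le
    _ = (2 * π * |b|) ^ i * expWeight ν b y := mul_one _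
    _ = _ := by rw [← hexp]; rfl

/-! ### The deformed test function `ψ_b = e_b ψ` -/

/-- `ψ_b(y) = e_b(y) ψ(y)`. [folklore] -/
def deform (ψ : V → E) (ν : V) (b : ℝ) : V → E := fun y => expWeight ν b y • ψ y

omit [FiniteDimensional ℝ V] [MeasurableSpace V] [BorelSpace V] in
/-- Unfolding `deform`. [folklore] -/
theorem deform_apply (ψ : V → E) (ν : V) (b : ℝ) (y : V) :
    deform ψ ν b y = expWeight ν b y • ψ y := rfl

omit [FiniteDimensional ℝ V] [MeasurableSpace V] [BorelSpace V] in
/-- `ψ_0 = ψ`. [folklore] -/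
theorem deform_zero (ψ : V → E) (ν : V) : deform ψ ν 0 = ψ := by
  funext y; simp [deform, expWeight_zero]

omit [FiniteDimensional ℝ V] [MeasurableSpace V] [BorelSpace V] in
/-- `ψ_b` is smooth. [folklore] -/
theorem contDiff_deform {ψ : V → E} {n : WithTop ℕ∞} (hψ : ContDiff ℝ n ψ) (ν : V) (b : ℝ) :
    ContDiff ℝ n (deform ψ ν b) :=
  (contDiff_expWeight ν b).smul hψ

omit [FiniteDimensional ℝ V] [MeasurableSpace V] [BorelSpace V] in
/-- `supp ψ_b = supp ψ`. [folklore] -/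
theorem support_deform (ψ : V → E) (ν : V) (b : ℝ) :
    Function.support (deform ψ ν b) = Function.support ψ := by
  ext y
  simp [deform, (expWeight_pos ν b y).ne']

omit [FiniteDimensional ℝ V] [MeasurableSpace V] [BorelSpace V] in
/-- `tsupport ψ_b = tsupport ψ`. [folklore] -/
theorem tsupport_deform (ψ : V → E) (ν : V) (b : ℝ) :
    tsupport (deform ψ ν b) = tsupport ψ := by
  rw [tsupport, tsupport, support_deform]

omit [FiniteDimensional ℝ V] [MeasurableSpace V] [BorelSpace V] in
/-- `ψ_b` has compact support if `ψ` has. [folklore] -/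
theorem hasCompactSupport_deform {ψ : V → E} (hψ : HasCompactSupport ψ) (ν : V) (b : ℝ) :
    HasCompactSupport (deform ψ ν b) := by
  rw [HasCompactSupport, tsupport_deform]; exact hψ

/-- The sum of the pointwise norms of the derivatives of orders `≤ n`. [folklore] -/
def derivNormSum (n : ℕ) (ψ : V → E) (y : V) : ℝ :=
  ∑ j ∈ Finset.range (n + 1), ‖iteratedFDeriv ℝ j ψ y‖

omit [FiniteDimensional ℝ V] [MeasurableSpace V] [BorelSpace V] in
/-- `derivNormSum ≥ 0`. [folklore] -/
theorem derivNormSum_nonneg (n : ℕ) (ψ : V → E) (y : V) : 0 ≤ derivNormSum n ψ y :=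
  Finset.sum_nonneg fun _ _ => norm_nonneg _

omit [FiniteDimensional ℝ V] [MeasurableSpace V] [BorelSpace V] in
/-- Each derivative norm is at most the sum. [folklore] -/
theorem norm_iteratedFDeriv_le_derivNormSum {n j : ℕ} (hj : j ≤ n) (ψ : V → E) (y : V) :
    ‖iteratedFDeriv ℝ j ψ y‖ ≤ derivNormSum n ψ y :=
  Finset.single_le_sum (f := fun j => ‖iteratedFDeriv ℝ j ψ y‖) (fun _ _ => norm_nonneg _)
    (Finset.mem_range.2 (Nat.lt_succ_of_le hj))

omit [FiniteDimensional ℝ V] [MeasurableSpace V] [BorelSpace V] in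
/-- Monotone in the order. [folklore] -/
theorem derivNormSum_mono {m n : ℕ} (h : m ≤ n) (ψ : V → E) (y : V) :
    derivNormSum m ψ y ≤ derivNormSum n ψ y :=
  Finset.sum_le_sum_of_subset_of_nonneg (Finset.range_mono (by omega)) fun _ _ _ => norm_nonneg _

omit [FiniteDimensional ℝ V] [MeasurableSpace V] [BorelSpace V] in
/-- **Leibniz bound for the deformed test function**: if `supp ψ ⊆ B̄(0, ρ)` and `‖ν‖ ≤ 1` then
`‖Dⁿψ_b(y)‖ ≤ 2ⁿ (1 + 2π|b|)ⁿ e^{2πρ|b|} Σ_{j ≤ n} ‖Dʲψ(y)‖`. [folklore] -/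
theorem norm_iteratedFDeriv_deform_le {ψ : V → E} (hψ : ContDiff ℝ ∞ ψ) {ρ : ℝ}
    (hsupp : tsupport ψ ⊆ closedBall (0 : V) ρ) {ν : V} (hν : ‖ν‖ ≤ 1) (b : ℝ) (n : ℕ)
    (y : V) :
    ‖iteratedFDeriv ℝ n (deform ψ ν b) y‖ ≤
      2 ^ n * (1 + 2 * π * |b|) ^ n * Real.exp (2 * π * ρ * |b|) * derivNormSum n ψ y := by
  have hL := norm_iteratedFDeriv_smul_le (𝕜 := ℝ) (contDiff_expWeight ν b (n := (⊤ : ℕ∞)))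
    hψ y (n := n) (by exact_mod_cast le_top)
  refine hL.trans ?_
  -- bound each term of the Leibniz sum
  set K : ℝ := 2 ^ n * (1 + 2 * π * |b|) ^ n * Real.exp (2 * π * ρ * |b|) with hK
  have hK0 : 0 ≤ K := by positivity
  have hterm : ∀ i ∈ Finset.range (n + 1),
      (n.choose i : ℝ) * ‖iteratedFDeriv ℝ i (expWeight ν b) y‖ *
          ‖iteratedFDeriv ℝ (n - i) ψ y‖ ≤ K * ‖iteratedFDeriv ℝ (n - i) ψ y‖ := by
    intro i hi
    have hi' : i ≤ n := Nat.lt_succ_iff.1 (Finset.mem_range.1 hi)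
    by_cases hy : y ∈ closedBall (0 : V) ρ
    · refine mul_le_mul_of_nonneg_right ?_ (norm_nonneg _)
      have hyρ : ‖y‖ ≤ ρ := mem_closedBall_zero_iff.1 hy
      have hchoose : (n.choose i : ℝ) ≤ 2 ^ n := by exact_mod_cast Nat.choose_le_two_pow n i
      have hD := norm_iteratedFDeriv_expWeight_le hν b i y
      have hw := expWeight_le hν b hyρ
      have h2pb : 0 ≤ 2 * π * |b| := by positivity
      have hpow : (2 * π * |b|) ^ i ≤ (1 + 2 * π * |b|) ^ n :=
        (pow_le_pow_left₀ h2pb (by linarith) i).trans (pow_le_pow_right₀ (by linarith) hi')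
      calc (n.choose i : ℝ) * ‖iteratedFDeriv ℝ i (expWeight ν b) y‖
          ≤ 2 ^ n * ((2 * π * |b|) ^ i * expWeight ν b y) :=
            mul_le_mul hchoose hD (norm_nonneg _) (by positivity)
        _ ≤ 2 ^ n * ((1 + 2 * π * |b|) ^ n * Real.exp (2 * π * ρ * |b|)) :=
            mul_le_mul_of_nonneg_left (mul_le_mul hpow hw (expWeight_pos ν b y).le
              (by positivity)) (by positivity)
        _ = K := by rw [hK]; ring
    · -- outside the support all derivatives of `ψ` vanish
      have hzero : iteratedFDeriv ℝ (n - i) ψ y = 0 := by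
        refine image_eq_zero_of_notMem_tsupport fun h => hy ?_
        exact hsupp (tsupport_iteratedFDeriv_subset (n := n - i) h)
      rw [hzero, norm_zero, mul_zero, mul_zero]
  calc ∑ i ∈ Finset.range (n + 1), (n.choose i : ℝ) * ‖iteratedFDeriv ℝ i (expWeight ν b) y‖ *
        ‖iteratedFDeriv ℝ (n - i) ψ y‖
      ≤ ∑ i ∈ Finset.range (n + 1), K * ‖iteratedFDeriv ℝ (n - i) ψ y‖ := Finset.sum_le_sum hterm
    _ = K * ∑ i ∈ Finset.range (n + 1), ‖iteratedFDeriv ℝ (n - i) ψ y‖ := by rw [Finset.mul_sum]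
    _ = K * derivNormSum n ψ y := by
        congr 1
        unfold derivNormSum
        refine Finset.sum_nbij' (fun i => n - i) (fun j => n - j) ?_ ?_ ?_ ?_ ?_
        · intro i hi; simp only [Finset.mem_range] at hi ⊢; omega
        · intro j hj; simp only [Finset.mem_range] at hj ⊢; omega
        · intro i hi; simp only [Finset.mem_range] at hi; show n - (n - i) = i; omega
        · intro j hj; simp only [Finset.mem_range] at hj; show n - (n - j) = j; omega
        · intro i _; rfl

/-- Integrated form: `∫ ‖Dⁿψ_b‖ ≤ 2ⁿ(1 + 2π|b|)ⁿ e^{2πρ|b|} Σ_{j≤n} ∫‖Dʲψ‖`. [folklore] -/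
theorem integral_norm_iteratedFDeriv_deform_le {ψ : V → E} (hψ : ContDiff ℝ ∞ ψ)
    (hc : HasCompactSupport ψ) {ρ : ℝ} (hsupp : tsupport ψ ⊆ closedBall (0 : V) ρ) {ν : V}
    (hν : ‖ν‖ ≤ 1) (b : ℝ) (n : ℕ) :
    ∫ y, ‖iteratedFDeriv ℝ n (deform ψ ν b) y‖ ≤
      2 ^ n * (1 + 2 * π * |b|) ^ n * Real.exp (2 * π * ρ * |b|) *
        ∑ j ∈ Finset.range (n + 1), ∫ y, ‖iteratedFDeriv ℝ j ψ y‖ := by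
  have hint : ∀ j, Integrable (fun y => ‖iteratedFDeriv ℝ j ψ y‖) := fun j =>
    ((hψ.continuous_iteratedFDeriv (by exact_mod_cast le_top)).norm).integrable_of_hasCompactSupport
      (hc.iteratedFDeriv j).norm
  rw [← integral_finsetSum _ fun j _ => hint j, ← integral_const_mul]
  refine integral_mono_of_nonneg (Eventually.of_forall fun y => norm_nonneg _)
    ((integrable_finsetSum _ fun j _ => hint j).const_mul _)
    (Eventually.of_forall fun y => ?_)
  exact norm_iteratedFDeriv_deform_le hψ hsupp hν b n y

/-! ### Decay of the Fourier transform of the deformed test function -/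

/-- The integrated derivative norms `Σ_{j ≤ D} ∫ ‖Dʲψ‖`. [folklore] -/
def derivIntSum (D : ℕ) (ψ : V → E) : ℝ :=
  ∑ j ∈ Finset.range (D + 1), ∫ y, ‖iteratedFDeriv ℝ j ψ y‖

/-- `derivIntSum ≥ 0`. [folklore] -/
theorem derivIntSum_nonneg (D : ℕ) (ψ : V → E) : 0 ≤ derivIntSum D ψ :=
  Finset.sum_nonneg fun _ _ => integral_nonneg fun _ => norm_nonneg _

/-- Monotone in `D`. [folklore] -/
theorem derivIntSum_mono {m D : ℕ} (h : m ≤ D) (ψ : V → E) : derivIntSum m ψ ≤ derivIntSum D ψ :=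
  Finset.sum_le_sum_of_subset_of_nonneg (Finset.range_mono (by omega))
    fun _ _ _ => integral_nonneg fun _ => norm_nonneg _

/-- Mathlib's decay estimate specialised: `‖w‖^D ‖𝓕ψ_b(w)‖ ≤ 2^D Σ_{n ≤ D} ∫ ‖Dⁿψ_b‖`.
[folklore] -/
theorem pow_mul_norm_fourier_deform_le {ψ : V → E} (hψ : ContDiff ℝ ∞ ψ)
    (hc : HasCompactSupport ψ) (ν : V) (b : ℝ) (D : ℕ) (w : V) :
    ‖w‖ ^ D * ‖𝓕 (deform ψ ν b) w‖ ≤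
      2 ^ D * ∑ n ∈ Finset.range (D + 1), ∫ y, ‖iteratedFDeriv ℝ n (deform ψ ν b) y‖ := by
  have hfD : ContDiff ℝ (D : ℕ∞) (deform ψ ν b) :=
    (contDiff_deform hψ ν b).of_le (by exact_mod_cast le_top)
  have hcD : HasCompactSupport (deform ψ ν b) := hasCompactSupport_deform hc ν b
  have h'f : ∀ k n : ℕ, (k : ℕ∞) ≤ (0 : ℕ) → (n : ℕ∞) ≤ D →
      Integrable (fun v => ‖v‖ ^ k * ‖iteratedFDeriv ℝ n (deform ψ ν b) v‖) := by
    intro k n _ hn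
    have hcont : Continuous fun v => ‖v‖ ^ k * ‖iteratedFDeriv ℝ n (deform ψ ν b) v‖ :=
      (continuous_norm.pow k).mul (hfD.continuous_iteratedFDeriv (by exact_mod_cast hn)).norm
    exact hcont.integrable_of_hasCompactSupport ((hcD.iteratedFDeriv n).norm.mul_left)
  have h := Real.pow_mul_norm_iteratedFDeriv_fourier_le (K := (0 : ℕ)) (N := (D : ℕ)) hfD h'f
    (k := 0) (n := D) le_rfl le_rfl w
  rw [norm_iteratedFDeriv_zero] at h
  refine h.trans (le_of_eq ?_)
  rw [pow_zero, one_mul, Finset.range_one, Finset.sum_product, Finset.sum_singleton]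
  simp only [pow_zero, one_mul, Nat.cast_zero, mul_zero, zero_add]

/-- **Decay of `𝓕ψ_b`**: for `supp ψ ⊆ B̄(0, ρ)`, `‖ν‖ ≤ 1` and every `D`,
`(1 + ‖w‖^D) ‖𝓕ψ_b(w)‖ ≤ (1 + 4^D (D+1)) (1 + 2π|b|)^D e^{2πρ|b|} Σ_{j≤D} ∫‖Dʲψ‖`.
[folklore] -/
theorem norm_fourier_deform_le {ψ : V → E} (hψ : ContDiff ℝ ∞ ψ) (hc : HasCompactSupport ψ)
    {ρ : ℝ} (hsupp : tsupport ψ ⊆ closedBall (0 : V) ρ) {ν : V} (hν : ‖ν‖ ≤ 1) (b : ℝ) (D : ℕ)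
    (w : V) :
    (1 + ‖w‖ ^ D) * ‖𝓕 (deform ψ ν b) w‖ ≤
      (1 + 4 ^ D * (D + 1)) * (1 + 2 * π * |b|) ^ D * Real.exp (2 * π * ρ * |b|) *
        derivIntSum D ψ := by
  set A : ℝ := (1 + 2 * π * |b|) ^ D * Real.exp (2 * π * ρ * |b|) * derivIntSum D ψ with hA
  have hI0 := derivIntSum_nonneg D ψ
  have hA0 : 0 ≤ A := by positivity
  have hb0 : 0 ≤ 2 * π * |b| := by positivity
  have hb1 : 1 ≤ 1 + 2 * π * |b| := by linarith
  -- the `L¹` bounds of the derivatives of `ψ_b` of order `n ≤ D`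
  have hn : ∀ n ≤ D, ∫ y, ‖iteratedFDeriv ℝ n (deform ψ ν b) y‖ ≤ 2 ^ D * A := by
    intro n hn
    refine (integral_norm_iteratedFDeriv_deform_le hψ hc hsupp hν b n).trans ?_
    have h2 : (2 : ℝ) ^ n ≤ 2 ^ D := pow_le_pow_right₀ one_le_two hn
    have h3 : (1 + 2 * π * |b|) ^ n ≤ (1 + 2 * π * |b|) ^ D := pow_le_pow_right₀ hb1 hn
    have h4 : ∑ j ∈ Finset.range (n + 1), ∫ y, ‖iteratedFDeriv ℝ j ψ y‖ ≤ derivIntSum D ψ :=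
      derivIntSum_mono hn ψ
    have h5 : 0 ≤ ∑ j ∈ Finset.range (n + 1), ∫ y, ‖iteratedFDeriv ℝ j ψ y‖ :=
      derivIntSum_nonneg n ψ
    rw [hA]
    calc 2 ^ n * (1 + 2 * π * |b|) ^ n * Real.exp (2 * π * ρ * |b|) *
          ∑ j ∈ Finset.range (n + 1), ∫ y, ‖iteratedFDeriv ℝ j ψ y‖
        ≤ 2 ^ D * (1 + 2 * π * |b|) ^ D * Real.exp (2 * π * ρ * |b|) * derivIntSum D ψ := by
          gcongr
    _ = _ := by ring
  -- the zeroth-order bound: `‖𝓕ψ_b(w)‖ ≤ ∫‖ψ_b‖ ≤ A`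
  have h0 : ‖𝓕 (deform ψ ν b) w‖ ≤ A := by
    refine (VectorFourier.norm_fourierIntegral_le_integral_norm _ _ _ _ _).trans ?_
    have h := integral_norm_iteratedFDeriv_deform_le hψ hc hsupp hν b 0
    simp only [pow_zero, one_mul, zero_add, Finset.range_one, Finset.sum_singleton,
      norm_iteratedFDeriv_zero] at h
    refine h.trans ?_
    have h4 : ∫ y, ‖ψ y‖ ≤ derivIntSum D ψ := by
      have := derivIntSum_mono (Nat.zero_le D) ψ
      simpa [derivIntSum] using this
    have h3 : (1 : ℝ) ≤ (1 + 2 * π * |b|) ^ D := one_le_pow₀ hb1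
    have h6 : 0 ≤ ∫ y, ‖ψ y‖ := integral_nonneg fun _ => norm_nonneg _
    rw [hA]
    calc Real.exp (2 * π * ρ * |b|) * ∫ y, ‖ψ y‖
        = 1 * Real.exp (2 * π * ρ * |b|) * ∫ y, ‖ψ y‖ := by ring
      _ ≤ (1 + 2 * π * |b|) ^ D * Real.exp (2 * π * ρ * |b|) * derivIntSum D ψ := by
          gcongr
  -- the order-`D` bound
  have hD : ‖w‖ ^ D * ‖𝓕 (deform ψ ν b) w‖ ≤ 4 ^ D * (D + 1) * A := by
    refine (pow_mul_norm_fourier_deform_le hψ hc ν b D w).trans ?_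
    calc (2 : ℝ) ^ D * ∑ n ∈ Finset.range (D + 1), ∫ y, ‖iteratedFDeriv ℝ n (deform ψ ν b) y‖
        ≤ 2 ^ D * ∑ _n ∈ Finset.range (D + 1), 2 ^ D * A :=
          mul_le_mul_of_nonneg_left (Finset.sum_le_sum fun n hn' =>
            hn n (Nat.lt_succ_iff.1 (Finset.mem_range.1 hn'))) (by positivity)
      _ = 4 ^ D * (D + 1) * A := by
          rw [Finset.sum_const, Finset.card_range, nsmul_eq_mul,
            show (4 : ℝ) ^ D = 2 ^ D * 2 ^ D by rw [← mul_pow]; norm_num]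
          push_cast
          ring
  calc (1 + ‖w‖ ^ D) * ‖𝓕 (deform ψ ν b) w‖
      = ‖𝓕 (deform ψ ν b) w‖ + ‖w‖ ^ D * ‖𝓕 (deform ψ ν b) w‖ := by ring
    _ ≤ A + 4 ^ D * (D + 1) * A := add_le_add h0 hD
    _ = (1 + 4 ^ D * (D + 1)) * (1 + 2 * π * |b|) ^ D * Real.exp (2 * π * ρ * |b|) *
        derivIntSum D ψ := by rw [hA]; ring

/-! ### Integrability of `(1 + ‖w‖^D)⁻¹` for `D > dim V` -/

omit [NormedAddCommGroup V] [InnerProductSpace ℝ V] [FiniteDimensional ℝ V] [MeasurableSpace V]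
  [BorelSpace V] in
/-- `(1 + t)^D ≤ 2^D (1 + t^D)` for `t ≥ 0`. [folklore] -/
private theorem one_add_pow_le_two_pow_mul {t : ℝ} (ht : 0 ≤ t) (D : ℕ) :
    (1 + t) ^ D ≤ 2 ^ D * (1 + t ^ D) := by
  have h1 : 1 + t ≤ 2 * max 1 t := by
    rcases le_total t 1 with h | h
    · rw [max_eq_left h]; linarith
    · rw [max_eq_right h]; linarith
  have h2 : (max 1 t) ^ D ≤ 1 + t ^ D := by
    rcases le_total t 1 with h | h
    · rw [max_eq_left h, one_pow]; linarith [pow_nonneg ht D]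
    · rw [max_eq_right h]; linarith
  calc (1 + t) ^ D ≤ (2 * max 1 t) ^ D := pow_le_pow_left₀ (by linarith) h1 D
    _ = 2 ^ D * (max 1 t) ^ D := mul_pow _ _ _
    _ ≤ 2 ^ D * (1 + t ^ D) := mul_le_mul_of_nonneg_left h2 (by positivity)

/-- `w ↦ (1 + ‖w‖^D)⁻¹` is integrable on `V` for `D > dim V`. [folklore] -/
theorem integrable_inv_one_add_norm_pow [(volume : Measure V).IsAddHaarMeasure] {D : ℕ}
    (hD : Module.finrank ℝ V < D) :
    Integrable fun w : V => (1 + ‖w‖ ^ D)⁻¹ := by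
  have hint := integrable_one_add_norm (E := V) (μ := volume) (r := D) (by exact_mod_cast hD)
  refine (hint.const_mul (2 ^ D)).mono' ?_ (Eventually.of_forall fun w => ?_)
  · exact ((continuous_const.add (continuous_norm.pow D)).inv₀
      fun w => (by positivity : (0 : ℝ) < 1 + ‖w‖ ^ D).ne').aestronglyMeasurable
  · have hpos : 0 < 1 + ‖w‖ ^ D := by positivity
    have h1w : 0 < 1 + ‖w‖ := by positivity
    have hpos' : 0 < (1 + ‖w‖) ^ D := pow_pos h1w D
    have hrpow : (1 + ‖w‖) ^ (-(D : ℝ)) = ((1 + ‖w‖) ^ D)⁻¹ := by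
      rw [Real.rpow_neg h1w.le, Real.rpow_natCast]
    rw [Real.norm_of_nonneg (inv_nonneg.2 hpos.le), hrpow]
    -- `(1 + ‖w‖^D)⁻¹ ≤ 2^D ((1 + ‖w‖)^D)⁻¹` iff `(1 + ‖w‖)^D ≤ 2^D (1 + ‖w‖^D)`
    have key := one_add_pow_le_two_pow_mul (norm_nonneg w) D
    rw [inv_le_iff_one_le_mul₀ hpos]
    calc (1 : ℝ) = (2 ^ D * ((1 + ‖w‖) ^ D)⁻¹) * ((1 + ‖w‖) ^ D / 2 ^ D) := by
          field_simp
      _ ≤ (2 ^ D * ((1 + ‖w‖) ^ D)⁻¹) * (1 + ‖w‖ ^ D) := by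
          refine mul_le_mul_of_nonneg_left ?_ (by positivity)
          rw [div_le_iff₀ (by positivity), mul_comm]
          exact key

/-- **`L¹` bound for `𝓕ψ_b`**: with `D = dim V + 1` and `I_D = ∫ (1 + ‖w‖^D)⁻¹`,
`∫ ‖𝓕ψ_b‖ ≤ (1 + 4^D(D+1)) (1 + 2π|b|)^D e^{2πρ|b|} (Σ_{j≤D} ∫‖Dʲψ‖) I_D`. [folklore] -/
theorem integral_norm_fourier_deform_le [(volume : Measure V).IsAddHaarMeasure] {ψ : V → E}
    (hψ : ContDiff ℝ ∞ ψ) (hc : HasCompactSupport ψ) {ρ : ℝ}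
    (hsupp : tsupport ψ ⊆ closedBall (0 : V) ρ) {ν : V} (hν : ‖ν‖ ≤ 1) (b : ℝ) :
    ∫ w, ‖𝓕 (deform ψ ν b) w‖ ≤
      (1 + 4 ^ (Module.finrank ℝ V + 1) * ((Module.finrank ℝ V + 1 : ℕ) + 1)) *
        (1 + 2 * π * |b|) ^ (Module.finrank ℝ V + 1) * Real.exp (2 * π * ρ * |b|) *
        derivIntSum (Module.finrank ℝ V + 1) ψ * ∫ w : V, (1 + ‖w‖ ^ (Module.finrank ℝ V + 1))⁻¹ := by
  set D := Module.finrank ℝ V + 1 with hDdef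
  set C := (1 + 4 ^ D * ((D : ℕ) + 1 : ℝ)) * (1 + 2 * π * |b|) ^ D * Real.exp (2 * π * ρ * |b|) *
    derivIntSum D ψ with hC
  have hC0 : 0 ≤ C := by
    have := derivIntSum_nonneg D ψ
    positivity
  have hI := integrable_inv_one_add_norm_pow (V := V) (D := D) (by omega)
  have hpt : ∀ w : V, ‖𝓕 (deform ψ ν b) w‖ ≤ C * (1 + ‖w‖ ^ D)⁻¹ := by
    intro w
    have hpos : 0 < 1 + ‖w‖ ^ D := by positivity
    rw [← div_eq_mul_inv, le_div_iff₀ hpos, mul_comm]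
    have := norm_fourier_deform_le hψ hc hsupp hν b D w
    rw [hC]
    exact_mod_cast this
  calc ∫ w, ‖𝓕 (deform ψ ν b) w‖ ≤ ∫ w, C * (1 + ‖w‖ ^ D)⁻¹ := by
        refine integral_mono_of_nonneg (Eventually.of_forall fun w => norm_nonneg _)
          (hI.const_mul C) (Eventually.of_forall hpt)
    _ = C * ∫ w : V, (1 + ‖w‖ ^ D)⁻¹ := integral_const_mul _ _

/-! ### The weighted companion `ψ̃(y) = 2π⟪y, ν⟫ ψ(y)` and the `b`-derivative of `ψ_b` -/

/-- `ψ̃(y) = (2π⟪y, ν⟫) ψ(y)`; then `∂_b ψ_b = (ψ̃)_b`. [folklore] -/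
def innerWeight (ψ : V → E) (ν : V) : V → E := fun y => ((2 * π * ⟪y, ν⟫ : ℝ) : ℂ) • ψ y

omit [FiniteDimensional ℝ V] [MeasurableSpace V] [BorelSpace V] in
/-- Unfolding `innerWeight`. [folklore] -/
theorem innerWeight_apply (ψ : V → E) (ν : V) (y : V) :
    innerWeight ψ ν y = ((2 * π * ⟪y, ν⟫ : ℝ) : ℂ) • ψ y := rfl

omit [FiniteDimensional ℝ V] [MeasurableSpace V] [BorelSpace V] in
/-- `ψ̃` is smooth. [folklore] -/
theorem contDiff_innerWeight {ψ : V → E} {n : WithTop ℕ∞} (hψ : ContDiff ℝ n ψ) (ν : V) :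
    ContDiff ℝ n (innerWeight ψ ν) := by
  have h0 : ContDiff ℝ n fun y : V => 2 * π * ⟪y, ν⟫ := by
    have : (fun y : V => 2 * π * ⟪y, ν⟫) = fun y => 2 * π * (innerSL ℝ ν) y := by
      funext y; simp [real_inner_comm]
    rw [this]
    exact contDiff_const.mul (innerSL ℝ ν).contDiff
  have h1 : ContDiff ℝ n fun y : V => ((2 * π * ⟪y, ν⟫ : ℝ) : ℂ) := ofRealCLM.contDiff.comp h0
  exact h1.smul hψ

omit [FiniteDimensional ℝ V] [MeasurableSpace V] [BorelSpace V] in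
/-- `tsupport ψ̃ ⊆ tsupport ψ`. [folklore] -/
theorem tsupport_innerWeight_subset (ψ : V → E) (ν : V) :
    tsupport (innerWeight ψ ν) ⊆ tsupport ψ :=
  tsupport_smul_subset_right _ _

omit [FiniteDimensional ℝ V] [MeasurableSpace V] [BorelSpace V] in
/-- `ψ̃` has compact support if `ψ` has. [folklore] -/
theorem hasCompactSupport_innerWeight {ψ : V → E} (hψ : HasCompactSupport ψ) (ν : V) :
    HasCompactSupport (innerWeight ψ ν) :=
  hψ.mono' ((tsupport_innerWeight_subset ψ ν).trans' subset_rfl |> fun h =>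
    (subset_tsupport _).trans h)

/-! ### Derivatives of `𝓕ψ_b` in the frequency (along a direction) and in `b` -/

section FourierDeriv

/-- `fourierSMulRight (innerSL ℝ) f` is integrable for continuous compactly supported `f`.
[folklore] -/
theorem integrable_fourierSMulRight_of_hasCompactSupport {f : V → E} (hf : Continuous f)
    (hc : HasCompactSupport f) :
    Integrable (VectorFourier.fourierSMulRight (innerSL ℝ) f) := by
  have hcont : Continuous fun v => VectorFourier.fourierSMulRight (innerSL ℝ) f v := by
    have h1 : Continuous fun v => (ContinuousLinearMap.smulRightL ℝ V E) (innerSL ℝ v) (f v) :=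
      ((ContinuousLinearMap.smulRightL ℝ V E).continuous₂).comp ((innerSL ℝ).continuous.prodMk hf)
    show Continuous ((-(2 * π * I)) • fun v => (innerSL ℝ v).smulRight (f v))
    exact h1.const_smul _
  refine hcont.integrable_of_hasCompactSupport (hc.mono fun v hv => ?_)
  rw [Function.mem_support] at hv ⊢
  contrapose! hv
  simp [VectorFourier.fourierSMulRight, hv]

/-- **Directional frequency derivative of `𝓕f`** for `f ∈ C_c`:
`d/ds 𝓕f(ξ + s u)|₀ = 𝓕[v ↦ -2πi⟪v, u⟫ f(v)](ξ)`. [folklore] -/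
theorem hasDerivAt_fourier_line {f : V → E} (hf : Continuous f) (hc : HasCompactSupport f)
    (ξ u : V) :
    HasDerivAt (fun s : ℝ => 𝓕 f (ξ + s • u))
      (𝓕 (fun v => (-(2 * π * I * ⟪v, u⟫)) • f v) ξ) 0 := by
  have hfi : Integrable f := hf.integrable_of_hasCompactSupport hc
  have hvf : Integrable fun v => ‖v‖ * ‖f v‖ :=
    (continuous_norm.mul hf.norm).integrable_of_hasCompactSupport hc.norm.mul_left
  have hF := Real.hasFDerivAt_fourier hfi hvf ξ
  have hγ : HasDerivAt (fun s : ℝ => ξ + s • u) u 0 := by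
    simpa using ((hasDerivAt_id (0 : ℝ)).smul_const u).const_add ξ
  have h := HasFDerivAt.comp_hasDerivAt_of_eq (x := (0 : ℝ)) hF hγ (by simp)
  -- evaluate the operator-valued Fourier transform at `u`
  have heval : (𝓕 (VectorFourier.fourierSMulRight (innerSL ℝ) f) ξ) u =
      𝓕 (fun v => (-(2 * π * I * ⟪v, u⟫)) • f v) ξ := by
    rw [Real.fourier_continuousLinearMap_apply (V := V) (E := E) (F := V)
      (integrable_fourierSMulRight_of_hasCompactSupport hf hc)]
    have hfun : (fun v => (VectorFourier.fourierSMulRight (innerSL ℝ) f v) u) =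
        fun v => (-(2 * π * I * ⟪v, u⟫)) • f v := by
      funext v
      rw [VectorFourier.fourierSMulRight_apply, innerSL_apply_apply, ← Complex.coe_smul, smul_smul]
      congr 1
      ring
    rw [hfun]
  rw [← heval]
  exact h

omit [FiniteDimensional ℝ V] [MeasurableSpace V] [BorelSpace V] in
/-- `b ↦ e_b(v)` has derivative `2π⟪v, ν⟫ e_b(v)`. [folklore] -/
theorem hasDerivAt_expWeight (ν v : V) (b : ℝ) :
    HasDerivAt (fun b : ℝ => expWeight ν b v) (2 * π * ⟪v, ν⟫ * expWeight ν b v) b := by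
  unfold expWeight
  have hlin : HasDerivAt (fun b : ℝ => 2 * π * b * ⟪v, ν⟫) (2 * π * ⟪v, ν⟫) b := by
    have := ((hasDerivAt_id b).const_mul (2 * π)).mul_const ⟪v, ν⟫
    simpa using this
  have h := hlin.exp
  convert h using 1
  ring

omit [FiniteDimensional ℝ V] [MeasurableSpace V] [BorelSpace V] in
/-- `deform (ψ̃) = (2π⟪·,ν⟫) • deform ψ`. [folklore] -/
theorem deform_innerWeight (ψ : V → E) (ν : V) (b : ℝ) (v : V) :
    deform (innerWeight ψ ν) ν b v = ((2 * π * ⟪v, ν⟫ : ℝ) : ℂ) • deform ψ ν b v := by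
  simp only [deform, innerWeight]
  rw [smul_comm]

omit [FiniteDimensional ℝ V] [MeasurableSpace V] [BorelSpace V] in
/-- `e_b(v) ≤ exp(2π(|b₀|+1)‖v‖‖ν‖)` for `b ∈ B(b₀, 1)`. [folklore] -/
theorem expWeight_le_of_mem_ball {ν v : V} {b₀ b : ℝ} (hb : b ∈ ball b₀ 1) :
    expWeight ν b v ≤ Real.exp (2 * π * (|b₀| + 1) * (‖v‖ * ‖ν‖)) := by
  unfold expWeight
  refine Real.exp_le_exp.2 ?_
  have hb' : |b| ≤ |b₀| + 1 := by
    have : |b - b₀| < 1 := by simpa [Real.dist_eq] using mem_ball.1 hb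
    have := abs_sub_abs_le_abs_sub b b₀
    linarith
  have h1 : b * ⟪v, ν⟫ ≤ (|b₀| + 1) * (‖v‖ * ‖ν‖) := by
    calc b * ⟪v, ν⟫ ≤ |b * ⟪v, ν⟫| := le_abs_self _
      _ = |b| * |⟪v, ν⟫| := abs_mul _ _
      _ ≤ (|b₀| + 1) * (‖v‖ * ‖ν‖) :=
          mul_le_mul hb' (abs_real_inner_le_norm v ν) (abs_nonneg _) (by positivity)
  nlinarith [Real.pi_pos]

/-- **`b`-derivative of `𝓕ψ_b(ξ)`**: `d/db 𝓕ψ_b(ξ) = 𝓕[(ψ̃)_b](ξ)`, `ψ̃ = 2π⟪·,ν⟫ψ`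
(differentiation under the integral sign). [folklore] -/
theorem hasDerivAt_fourier_deform_param {ψ : V → E} (hψ : ContDiff ℝ ∞ ψ)
    (hc : HasCompactSupport ψ) (ν ξ : V) (b₀ : ℝ) :
    HasDerivAt (fun b : ℝ => 𝓕 (deform ψ ν b) ξ) (𝓕 (deform (innerWeight ψ ν) ν b₀) ξ) b₀ := by
  -- the integrands
  set F : ℝ → V → E := fun b v => (𝐞 (-⟪v, ξ⟫) : Circle) • deform ψ ν b v with hF
  set F' : ℝ → V → E := fun b v => (𝐞 (-⟪v, ξ⟫) : Circle) • deform (innerWeight ψ ν) ν b v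
    with hF'
  have hψc : Continuous ψ := hψ.continuous
  have hψ'c : Continuous (innerWeight ψ ν) := (contDiff_innerWeight hψ ν).continuous
  have hchar : Continuous fun v : V => (𝐞 (-⟪v, ξ⟫) : Circle) :=
    Real.continuous_fourierChar.comp (continuous_id.inner continuous_const).neg
  have hcontF : ∀ b, Continuous (F b) := fun b =>
    hchar.smul ((contDiff_deform (n := ∞) hψ ν b).continuous)
  have hcontF' : ∀ b, Continuous (F' b) := fun b =>
    hchar.smul ((contDiff_deform (n := ∞) (contDiff_innerWeight hψ ν) ν b).continuous)
  -- the dominating function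
  set bound : V → ℝ := fun v => Real.exp (2 * π * (|b₀| + 1) * (‖v‖ * ‖ν‖)) *
    ‖innerWeight ψ ν v‖ with hbound
  have hbound_cont : Continuous bound :=
    (Real.continuous_exp.comp (continuous_const.mul (continuous_norm.mul continuous_const))).mul
      hψ'c.norm
  have hbound_supp : HasCompactSupport bound :=
    (hasCompactSupport_innerWeight hc ν).norm.mul_left
  have hbound_int : Integrable bound := hbound_cont.integrable_of_hasCompactSupport hbound_supp
  have key := hasDerivAt_integral_of_dominated_loc_of_deriv_le (μ := (volume : Measure V))
    (F := F) (F' := F') (x₀ := b₀) (s := ball b₀ 1) (ball_mem_nhds b₀ one_pos)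
    (Eventually.of_forall fun b => (hcontF b).aestronglyMeasurable)
    ((hcontF b₀).integrable_of_hasCompactSupport ?_)
    (hcontF' b₀).aestronglyMeasurable
    (Eventually.of_forall fun v b hb => ?_) hbound_int
    (Eventually.of_forall fun v b _ => ?_)
  · simpa [hF, hF', Real.fourier_eq] using key.2
  · -- compact support of `F b₀`
    refine (hasCompactSupport_deform hc ν b₀).mono fun v hv => ?_
    rw [Function.mem_support] at hv ⊢
    contrapose! hv
    simp [hF, hv]
  · -- the domination `‖F' b v‖ ≤ bound v` on the ball
    simp only [hF', hbound, Circle.norm_smul, deform, norm_smul, Real.norm_eq_abs,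
      abs_of_pos (expWeight_pos ν b v)]
    exact mul_le_mul_of_nonneg_right (expWeight_le_of_mem_ball hb) (norm_nonneg _)
  · -- pointwise derivative in `b`
    simp only [hF, hF']
    have h1 := ((hasDerivAt_expWeight ν v b).smul_const (ψ v)).const_smul
      ((𝐞 (-⟪v, ξ⟫) : Circle) : ℂ)
    have heq : (2 * π * ⟪v, ν⟫ * expWeight ν b v) • ψ v = deform (innerWeight ψ ν) ν b v := by
      rw [deform_innerWeight, deform, ← Complex.coe_smul, ← Complex.coe_smul, smul_smul]
      push_cast
      ring_nf
    rw [← heq]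
    simp only [Circle.smul_def, deform] at h1 ⊢
    exact h1

/-- **Cauchy–Riemann for `𝓕ψ_b`**: `∂_b 𝓕ψ_b(ξ) = i · ∂_ν 𝓕ψ_b(ξ)`, i.e.
`𝓕[(ψ̃)_b](ξ) = i 𝓕[v ↦ -2πi⟪v,ν⟫ ψ_b(v)](ξ)`. [folklore] -/
theorem fourier_deform_innerWeight_eq (ψ : V → E) (ν : V) (b : ℝ) (ξ : V) :
    𝓕 (deform (innerWeight ψ ν) ν b) ξ =
      I • 𝓕 (fun v => (-(2 * π * I * ⟪v, ν⟫)) • deform ψ ν b v) ξ := by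
  rw [Real.fourier_eq, Real.fourier_eq, ← integral_smul]
  congr 1
  funext v
  rw [Circle.smul_def, Circle.smul_def, deform_innerWeight, smul_smul, smul_smul, smul_smul]
  congr 1
  have hI : I * I = -1 := I_mul_I
  push_cast
  linear_combination (2 * (π : ℂ) * (⟪v, ν⟫ : ℝ) * ((𝐞 (-⟪v, ξ⟫) : Circle) : ℂ)) * hI

end FourierDeriv

end PartB

/-! ## Part C: the deformation argument -/

section PartC

variable {V : Type*} [NormedAddCommGroup V] [InnerProductSpace ℝ V] [FiniteDimensional ℝ V]
  [MeasurableSpace V] [BorelSpace V] {k : ℕ}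

local notation "𝕄" => Matrix (Fin k) (Fin k) ℂ

/-! ### Matrix–vector product as a bounded bilinear map; entrywise bounds -/

/-- Derivative of `t ↦ M(t) w(t)`. [folklore] -/
theorem hasDerivAt_mulVec {M : ℝ → 𝕄} {w : ℝ → Fin k → ℂ} {M' : 𝕄} {w' : Fin k → ℂ} {t : ℝ}
    (hM : HasDerivAt M M' t) (hw : HasDerivAt w w' t) :
    HasDerivAt (fun t => M t *ᵥ w t) (M t *ᵥ w' + M' *ᵥ w t) t := by
  have h := (mulVecBilin (k := k)).hasDerivAt_of_bilinear (fun _ => hM) (fun _ => hw)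
  exact h

/-- Derivative of the triple product `t ↦ e(t) • (M(t) w(t))`. [folklore] -/
theorem hasDerivAt_smul_mulVec {e : ℝ → ℂ} {M : ℝ → 𝕄} {w : ℝ → Fin k → ℂ} {e' : ℂ} {M' : 𝕄}
    {w' : Fin k → ℂ} {t : ℝ} (he : HasDerivAt e e' t) (hM : HasDerivAt M M' t)
    (hw : HasDerivAt w w' t) :
    HasDerivAt (fun t => e t • (M t *ᵥ w t))
      (e' • (M t *ᵥ w t) + e t • (M' *ᵥ w t + M t *ᵥ w')) t := by
  have h := he.smul (hasDerivAt_mulVec hM hw)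
  refine h.congr_deriv ?_
  rw [add_comm (M t *ᵥ w')]
  abel

/-- Operator (max row sum) norm from an entrywise bound: `‖A‖ ≤ k C`. [folklore] -/
theorem linfty_opNorm_le_of_entry_le {A : 𝕄} {C : ℝ} (hC0 : 0 ≤ C) (hC : ∀ i j, ‖A i j‖ ≤ C) :
    ‖A‖ ≤ k * C := by
  rw [Matrix.linfty_opNorm_def]
  have : ((Finset.univ : Finset (Fin k)).sup fun i => ∑ j, ‖A i j‖₊) ≤ ⟨k * C, by positivity⟩ := by
    refine Finset.sup_le fun i _ => ?_
    rw [← NNReal.coe_le_coe, NNReal.coe_sum]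
    calc ∑ j, (‖A i j‖₊ : ℝ) = ∑ j, ‖A i j‖ := rfl
      _ ≤ ∑ _j : Fin k, C := Finset.sum_le_sum fun j _ => hC i j
      _ = k * C := by rw [Finset.sum_const, Finset.card_univ, Fintype.card_fin, nsmul_eq_mul]
  exact_mod_cast this

/-! ### The deformed symbol `M_b(ξ) = exp(Lξ + (bi) Lν)` -/

/-- The deformed symbol `M_b(ξ) = exp(Lξ + (ib) Lν)` ("the symbol `exp ∘ L` at the complex
frequency `ξ + ibν`"). [folklore] -/
def symM (L : V →L[ℝ] 𝕄) (ν : V) (b : ℝ) (ξ : V) : 𝕄 :=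
  NormedSpace.exp (L ξ + ((b : ℂ) * I) • L ν)

/-- Its complex derivative along the line `w ↦ Lξ + w Lν` at `w = ib`. [folklore] -/
def symD (L : V →L[ℝ] 𝕄) (ν : V) (b : ℝ) (ξ : V) : 𝕄 :=
  deriv (fun w : ℂ => NormedSpace.exp (L ξ + w • L ν)) ((b : ℂ) * I)

omit [FiniteDimensional ℝ V] [MeasurableSpace V] [BorelSpace V] in
/-- `M_0(ξ) = exp(Lξ)`. [folklore] -/
theorem symM_zero (L : V →L[ℝ] 𝕄) (ν ξ : V) : symM L ν 0 ξ = NormedSpace.exp (L ξ) := by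
  simp [symM]

omit [FiniteDimensional ℝ V] [MeasurableSpace V] [BorelSpace V] in
/-- `∂_b M_b(ξ) = i M'_b(ξ)`. [folklore] -/
theorem hasDerivAt_symM_param (L : V →L[ℝ] 𝕄) (ν ξ : V) (b : ℝ) :
    HasDerivAt (fun b : ℝ => symM L ν b ξ) (I • symD L ν b ξ) b := by
  have h := hasDerivAt_exp_add_smul_imag (L ξ) (L ν) 0 b
  simp only [zero_add] at h
  exact h

omit [FiniteDimensional ℝ V] [MeasurableSpace V] [BorelSpace V] in
/-- `L(ξ + sν) + (ib)Lν = Lξ + (ib + s)Lν`. [folklore] -/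
theorem map_add_smul_add (L : V →L[ℝ] 𝕄) (ν ξ : V) (b s : ℝ) :
    L (ξ + s • ν) + ((b : ℂ) * I) • L ν = L ξ + ((b : ℂ) * I + (s : ℂ)) • L ν := by
  rw [map_add, map_smul, add_smul, ← Complex.coe_smul]
  abel

omit [FiniteDimensional ℝ V] [MeasurableSpace V] [BorelSpace V] in
/-- `∂_s M_b(ξ + sν)|₀ = M'_b(ξ)`. [folklore] -/
theorem hasDerivAt_symM_line (L : V →L[ℝ] 𝕄) (ν ξ : V) (b : ℝ) :
    HasDerivAt (fun s : ℝ => symM L ν b (ξ + s • ν)) (symD L ν b ξ) 0 := by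
  have h := hasDerivAt_exp_add_smul_real (L ξ) (L ν) ((b : ℂ) * I) 0
  simp only [Complex.ofReal_zero, add_zero] at h
  have hfun : (fun s : ℝ => symM L ν b (ξ + s • ν)) =
      fun s : ℝ => NormedSpace.exp (L ξ + ((b : ℂ) * I + (s : ℂ)) • L ν) := by
    funext s
    rw [symM, map_add_smul_add]
  rw [hfun]
  exact h

/-! ### Bounds for the deformed symbol from the exponential-type hypothesis -/

/-- **Exponential type of the deformed symbols**: entrywise `|M_b(ξ)ᵢⱼ| ≤ C e^{γ|b|}` for all
frequencies `ξ`, unit directions `ν` and real `b`. [folklore] -/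
def HasExpType (L : V →L[ℝ] 𝕄) (C γ : ℝ) : Prop :=
  ∀ (ξ ν : V) (b : ℝ), ‖ν‖ ≤ 1 → ∀ i j, ‖symM L ν b ξ i j‖ ≤ C * Real.exp (γ * |b|)

omit [FiniteDimensional ℝ V] [MeasurableSpace V] [BorelSpace V] in
/-- Operator norm of the deformed symbol: `‖M_b(ξ)‖ ≤ k C e^{γ|b|}`. [folklore] -/
theorem HasExpType.norm_symM_le {L : V →L[ℝ] 𝕄} {C γ : ℝ} (h : HasExpType L C γ) (hC : 0 ≤ C)
    {ν : V} (hν : ‖ν‖ ≤ 1) (b : ℝ) (ξ : V) :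
    ‖symM L ν b ξ‖ ≤ k * (C * Real.exp (γ * |b|)) :=
  linfty_opNorm_le_of_entry_le (by positivity) (h ξ ν b hν)

omit [FiniteDimensional ℝ V] [MeasurableSpace V] [BorelSpace V] in
/-- The deformation family is closed under the scalings of Duhamel's formula:
`θ (Lξ + (ib)Lν + s Lν) = L(θ(ξ + sν)) + (iθb) Lν`. [folklore] -/
theorem smul_line_eq (L : V →L[ℝ] 𝕄) (ν ξ : V) (b s θ : ℝ) :
    θ • (L ξ + ((b : ℂ) * I) • L ν + (s : ℂ) • L ν) =
      L (θ • (ξ + s • ν)) + (((θ * b : ℝ) : ℂ) * I) • L ν := by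
  rw [map_smul, map_add, map_smul]
  ext i j
  simp only [Matrix.smul_apply, Matrix.add_apply, smul_eq_mul, Complex.real_smul]
  push_cast
  ring

omit [FiniteDimensional ℝ V] [MeasurableSpace V] [BorelSpace V] in
/-- **Bound for the line derivative**: `‖M'_b(ξ)‖ ≤ (k C e^{γ(|b|+1)})² ‖Lν‖` (Duhamel).
[folklore] -/
theorem HasExpType.norm_symD_le {L : V →L[ℝ] 𝕄} {C γ : ℝ} (h : HasExpType L C γ) (hC : 0 ≤ C)
    (hγ : 0 ≤ γ) {ν : V} (hν : ‖ν‖ ≤ 1) (b : ℝ) (ξ : V) :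
    ‖symD L ν b ξ‖ ≤ (k * (C * Real.exp (γ * (|b| + 1)))) ^ 2 * ‖L ν‖ := by
  -- translate the base point to `0`
  have htrans : symD L ν b ξ =
      deriv (fun w : ℂ => NormedSpace.exp ((L ξ + ((b : ℂ) * I) • L ν) + w • L ν)) 0 := by
    rw [symD]
    have := deriv_comp_const_add (f := fun w : ℂ => NormedSpace.exp (L ξ + w • L ν))
      ((b : ℂ) * I) 0
    rw [add_zero] at this
    refine this.symm.trans ?_
    congr 1
    funext w
    rw [add_smul, add_assoc]
  rw [htrans]
  refine norm_deriv_exp_add_smul_le _ _ (by positivity) fun θ hθ s hs => ?_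
  rw [smul_line_eq]
  -- this is `symM L ν (θ b) (θ(ξ + sν))`
  have := h.norm_symM_le hC hν (θ * b) (θ • (ξ + s • ν))
  refine (le_of_eq (by rfl)).trans (this.trans ?_)
  refine mul_le_mul_of_nonneg_left (mul_le_mul_of_nonneg_left (Real.exp_le_exp.2 ?_) hC)
    (Nat.cast_nonneg k)
  refine mul_le_mul_of_nonneg_left ?_ hγ
  rw [abs_mul, abs_of_nonneg hθ.1]
  calc θ * |b| ≤ 1 * |b| := mul_le_mul_of_nonneg_right hθ.2 (abs_nonneg b)
    _ ≤ |b| + 1 := by linarith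

/-! ### The phase factor `E_b(ξ) = e^{2πi⟪ξ, x⟫} e^{-2πb⟪x, ν⟫}` -/

/-- The deformed inverse-Fourier phase `E_b(ξ) = e^{2πi⟪ξ,x⟫} e^{-2πb⟪x,ν⟫}`
(the character `e^{2πi⟪ξ + ibν, x⟫}`). [folklore] -/
def phaseE (x ν : V) (b : ℝ) (ξ : V) : ℂ :=
  Complex.exp (((2 * π * ⟪ξ, x⟫ : ℝ) : ℂ) * I) * ((Real.exp (-(2 * π * b * ⟪x, ν⟫)) : ℝ) : ℂ)

omit [FiniteDimensional ℝ V] [MeasurableSpace V] [BorelSpace V] in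
/-- `|E_b(ξ)| = e^{-2πb⟪x,ν⟫}`. [folklore] -/
theorem norm_phaseE (x ν : V) (b : ℝ) (ξ : V) :
    ‖phaseE x ν b ξ‖ = Real.exp (-(2 * π * b * ⟪x, ν⟫)) := by
  rw [phaseE, norm_mul, Complex.norm_exp_ofReal_mul_I, one_mul, Complex.norm_real, Real.norm_eq_abs,
    abs_of_pos (Real.exp_pos _)]

omit [FiniteDimensional ℝ V] [MeasurableSpace V] [BorelSpace V] in
/-- `E_0(ξ) = e^{2πi⟪ξ, x⟫}`. [folklore] -/
theorem phaseE_zero (x ν ξ : V) :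
    phaseE x ν 0 ξ = Complex.exp (((2 * π * ⟪ξ, x⟫ : ℝ) : ℂ) * I) := by
  simp [phaseE]

omit [FiniteDimensional ℝ V] [MeasurableSpace V] [BorelSpace V] in
/-- `∂_b E_b(ξ) = -2π⟪x,ν⟫ E_b(ξ)`. [folklore] -/
theorem hasDerivAt_phaseE_param (x ν ξ : V) (b : ℝ) :
    HasDerivAt (fun b : ℝ => phaseE x ν b ξ)
      ((-(2 * π * ⟪x, ν⟫) : ℂ) * phaseE x ν b ξ) b := by
  unfold phaseE
  have hlin : HasDerivAt (fun b : ℝ => -(2 * π * b * ⟪x, ν⟫)) (-(2 * π * ⟪x, ν⟫)) b := by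
    have hfun : (fun b : ℝ => -(2 * π * b * ⟪x, ν⟫)) = fun b => b * (-(2 * π * ⟪x, ν⟫)) := by
      funext b; ring
    rw [hfun]
    exact hasDerivAt_mul_const _
  have h := (hlin.exp.ofReal_comp).const_mul (Complex.exp (((2 * π * ⟪ξ, x⟫ : ℝ) : ℂ) * I))
  refine h.congr_deriv ?_
  push_cast
  ring

omit [FiniteDimensional ℝ V] [MeasurableSpace V] [BorelSpace V] in
/-- `∂_s E_b(ξ + sν)|₀ = 2πi⟪ν,x⟫ E_b(ξ)`. [folklore] -/
theorem hasDerivAt_phaseE_line (x ν ξ : V) (b : ℝ) :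
    HasDerivAt (fun s : ℝ => phaseE x ν b (ξ + s • ν))
      ((2 * π * I * ⟪ν, x⟫) * phaseE x ν b ξ) 0 := by
  unfold phaseE
  -- the exponent as a function of `s`
  have hexpo : HasDerivAt (fun s : ℝ => (((2 * π * ⟪ξ + s • ν, x⟫ : ℝ) : ℂ) * I))
      (((2 * π * ⟪ν, x⟫ : ℝ) : ℂ) * I) 0 := by
    have hreal : HasDerivAt (fun s : ℝ => 2 * π * ⟪ξ + s • ν, x⟫) (2 * π * ⟪ν, x⟫) 0 := by
      have hfun : (fun s : ℝ => 2 * π * ⟪ξ + s • ν, x⟫) =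
          fun s => 2 * π * ⟪ξ, x⟫ + s * (2 * π * ⟪ν, x⟫) := by
        funext s; rw [inner_add_left, real_inner_smul_left]; ring
      rw [hfun]
      simpa using (hasDerivAt_mul_const (2 * π * ⟪ν, x⟫)).const_add (2 * π * ⟪ξ, x⟫)
    exact hreal.ofReal_comp.mul_const I
  have h := (hexpo.cexp).mul_const (((Real.exp (-(2 * π * b * ⟪x, ν⟫)) : ℝ) : ℂ))
  simp only [zero_smul, add_zero] at h
  refine h.congr_deriv ?_
  push_cast
  ring

omit [FiniteDimensional ℝ V] [MeasurableSpace V] [BorelSpace V] in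
/-- Cauchy–Riemann for the phase: `∂_b E = i ∂_ν E`. [folklore] -/
theorem phaseE_cr (x ν ξ : V) (b : ℝ) :
    (-(2 * π * ⟪x, ν⟫) : ℂ) * phaseE x ν b ξ = I * ((2 * π * I * ⟪ν, x⟫) * phaseE x ν b ξ) := by
  rw [real_inner_comm ν x]
  have hI : I * I = -1 := I_mul_I
  linear_combination (-(2 * (π : ℂ) * (⟪ν, x⟫ : ℝ) * phaseE x ν b ξ)) * hI

/-! ### The deformed integrand `Φ_b(ξ) = E_b(ξ) M_b(ξ) 𝓕ψ_b(ξ)` -/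

/-- `Φ_b(ξ) = E_b(ξ) • (M_b(ξ) 𝓕ψ_b(ξ))`. [folklore] -/
def defPhi (L : V →L[ℝ] 𝕄) (ψ : V → Fin k → ℂ) (x ν : V) (b : ℝ) (ξ : V) : Fin k → ℂ :=
  phaseE x ν b ξ • (symM L ν b ξ *ᵥ 𝓕 (deform ψ ν b) ξ)

/-- The `b`-derivative of `Φ_b(ξ)`. [folklore] -/
def defPhiDb (L : V →L[ℝ] 𝕄) (ψ : V → Fin k → ℂ) (x ν : V) (b : ℝ) (ξ : V) : Fin k → ℂ :=
  ((-(2 * π * ⟪x, ν⟫) : ℂ) * phaseE x ν b ξ) • (symM L ν b ξ *ᵥ 𝓕 (deform ψ ν b) ξ) +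
    phaseE x ν b ξ • ((I • symD L ν b ξ) *ᵥ 𝓕 (deform ψ ν b) ξ +
      symM L ν b ξ *ᵥ 𝓕 (deform (innerWeight ψ ν) ν b) ξ)

/-- The line derivative of `Φ_b` along `ν`. [folklore] -/
def defPhiDν (L : V →L[ℝ] 𝕄) (ψ : V → Fin k → ℂ) (x ν : V) (b : ℝ) (ξ : V) : Fin k → ℂ :=
  ((2 * π * I * ⟪ν, x⟫) * phaseE x ν b ξ) • (symM L ν b ξ *ᵥ 𝓕 (deform ψ ν b) ξ) +
    phaseE x ν b ξ • (symD L ν b ξ *ᵥ 𝓕 (deform ψ ν b) ξ +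
      symM L ν b ξ *ᵥ 𝓕 (fun v => (-(2 * π * I * ⟪v, ν⟫)) • deform ψ ν b v) ξ)

omit [FiniteDimensional ℝ V] [MeasurableSpace V] [BorelSpace V] in
/-- At `b = 0` the integrand is the inverse-Fourier integrand of `exp(L·)(D)ψ` at `x`.
[folklore] -/
theorem defPhi_zero [MeasurableSpace V] [BorelSpace V] [FiniteDimensional ℝ V]
    (L : V →L[ℝ] 𝕄) (ψ : V → Fin k → ℂ) (x ν ξ : V) :
    defPhi L ψ x ν 0 ξ =
      Complex.exp (((2 * π * ⟪ξ, x⟫ : ℝ) : ℂ) * I) • (NormedSpace.exp (L ξ) *ᵥ 𝓕 ψ ξ) := by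
  rw [defPhi, phaseE_zero, symM_zero, deform_zero]

/-- **`∂_b Φ_b(ξ)`**. [folklore] -/
theorem hasDerivAt_defPhi_param (L : V →L[ℝ] 𝕄) {ψ : V → Fin k → ℂ} (hψ : ContDiff ℝ ∞ ψ)
    (hc : HasCompactSupport ψ) (x ν ξ : V) (b : ℝ) :
    HasDerivAt (fun b : ℝ => defPhi L ψ x ν b ξ) (defPhiDb L ψ x ν b ξ) b := by
  have h := hasDerivAt_smul_mulVec (hasDerivAt_phaseE_param x ν ξ b)
    (hasDerivAt_symM_param L ν ξ b) (hasDerivAt_fourier_deform_param hψ hc ν ξ b)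
  exact h

/-- **`∂_ν Φ_b(ξ)`** (a line derivative). [folklore] -/
theorem hasLineDerivAt_defPhi (L : V →L[ℝ] 𝕄) {ψ : V → Fin k → ℂ} (hψ : ContDiff ℝ ∞ ψ)
    (hc : HasCompactSupport ψ) (x ν ξ : V) (b : ℝ) :
    HasLineDerivAt ℝ (defPhi L ψ x ν b) (defPhiDν L ψ x ν b ξ) ξ ν := by
  have h := hasDerivAt_smul_mulVec (hasDerivAt_phaseE_line x ν ξ b)
    (hasDerivAt_symM_line L ν ξ b)
    (hasDerivAt_fourier_line ((contDiff_deform (n := ∞) hψ ν b).continuous)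
      (hasCompactSupport_deform hc ν b) ξ ν)
  simp only [zero_smul, add_zero] at h
  exact h

/-- **Cauchy–Riemann for the integrand**: `∂_b Φ_b(ξ) = i ∂_ν Φ_b(ξ)`. [folklore] -/
theorem defPhiDb_eq (L : V →L[ℝ] 𝕄) (ψ : V → Fin k → ℂ) (x ν ξ : V) (b : ℝ) :
    defPhiDb L ψ x ν b ξ = I • defPhiDν L ψ x ν b ξ := by
  rw [defPhiDb, defPhiDν, fourier_deform_innerWeight_eq, phaseE_cr, Matrix.smul_mulVec,
    Matrix.mulVec_smul, smul_add, smul_add, mul_smul, smul_comm (phaseE x ν b ξ) I,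
    smul_comm (phaseE x ν b ξ) I, smul_add, smul_add]

/-! ### Majorants -/

section Majorant

/-- The constant in the decay bound of `𝓕χ_b` for `|b| ≤ β`:
`Q_β(χ) = (1 + 4^D(D+1)) (1 + 2πβ)^D e^{2πρβ} Σ_{j≤D} ∫‖Dʲχ‖`, `D = dim V + 1`. [folklore] -/
def fourierMajorant (ρ β : ℝ) (χ : V → Fin k → ℂ) : ℝ :=
  (1 + 4 ^ (Module.finrank ℝ V + 1) * ((Module.finrank ℝ V + 1 : ℕ) + 1 : ℝ)) *
    (1 + 2 * π * β) ^ (Module.finrank ℝ V + 1) * Real.exp (2 * π * ρ * β) *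
      derivIntSum (Module.finrank ℝ V + 1) χ

/-- `0 ≤ Q_β(χ)` for `β ≥ 0`. [folklore] -/
theorem fourierMajorant_nonneg {ρ β : ℝ} (hβ : 0 ≤ β) (χ : V → Fin k → ℂ) :
    0 ≤ fourierMajorant ρ β χ := by
  unfold fourierMajorant
  have := derivIntSum_nonneg (Module.finrank ℝ V + 1) χ
  positivity

/-- **Decay of `𝓕χ_b` uniformly for `|b| ≤ β`**: `‖𝓕χ_b(ξ)‖ ≤ Q_β(χ) (1 + ‖ξ‖^D)⁻¹`. [folklore] -/
theorem norm_fourier_deform_le_inv {χ : V → Fin k → ℂ} (hχ : ContDiff ℝ ∞ χ)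
    (hcχ : HasCompactSupport χ) {ρ : ℝ} (hρ : 0 ≤ ρ) (hsupp : tsupport χ ⊆ closedBall (0 : V) ρ)
    {ν : V} (hν : ‖ν‖ ≤ 1) {β b : ℝ} (hb : |b| ≤ β) (ξ : V) :
    ‖𝓕 (deform χ ν b) ξ‖ ≤
      fourierMajorant ρ β χ * (1 + ‖ξ‖ ^ (Module.finrank ℝ V + 1))⁻¹ := by
  set D := Module.finrank ℝ V + 1 with hD
  have hpos : 0 < 1 + ‖ξ‖ ^ D := by positivity
  rw [← div_eq_mul_inv, le_div_iff₀ hpos, mul_comm]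
  refine (norm_fourier_deform_le hχ hcχ hsupp hν b D ξ).trans ?_
  unfold fourierMajorant
  have hβ : 0 ≤ β := (abs_nonneg b).trans hb
  have h1 : (1 + 2 * π * |b|) ^ D ≤ (1 + 2 * π * β) ^ D :=
    pow_le_pow_left₀ (by positivity) (by nlinarith [Real.pi_pos]) D
  have h2 : Real.exp (2 * π * ρ * |b|) ≤ Real.exp (2 * π * ρ * β) :=
    Real.exp_le_exp.2 (mul_le_mul_of_nonneg_left hb (by positivity))
  have h3 := derivIntSum_nonneg D χ
  rw [← hD]
  gcongr

omit [FiniteDimensional ℝ V] [MeasurableSpace V] [BorelSpace V] in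
/-- `|E_b(ξ)| ≤ e^{2πβ‖x‖}` for `|b| ≤ β`, `‖ν‖ ≤ 1`. [folklore] -/
theorem norm_phaseE_le {x ν : V} (hν : ‖ν‖ ≤ 1) {β b : ℝ} (hb : |b| ≤ β) (ξ : V) :
    ‖phaseE x ν b ξ‖ ≤ Real.exp (2 * π * β * ‖x‖) := by
  rw [norm_phaseE]
  refine Real.exp_le_exp.2 ?_
  have h1 : |⟪x, ν⟫| ≤ ‖x‖ := by
    calc |⟪x, ν⟫| ≤ ‖x‖ * ‖ν‖ := abs_real_inner_le_norm x ν
      _ ≤ ‖x‖ * 1 := mul_le_mul_of_nonneg_left hν (norm_nonneg _)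
      _ = ‖x‖ := mul_one _
  have h2 : -(b * ⟪x, ν⟫) ≤ β * ‖x‖ := by
    calc -(b * ⟪x, ν⟫) ≤ |b * ⟪x, ν⟫| := neg_le_abs _
      _ = |b| * |⟪x, ν⟫| := abs_mul _ _
      _ ≤ β * ‖x‖ := mul_le_mul hb h1 (abs_nonneg _) ((abs_nonneg b).trans hb)
  nlinarith [Real.pi_pos]

/-- The common majorant constant for `Φ_b`, `∂_bΦ_b`, `∂_νΦ_b`, `|b| ≤ β`. [folklore] -/
def phiMajorant (L : V →L[ℝ] 𝕄) (C γ ρ : ℝ) (ψ : V → Fin k → ℂ) (x ν : V) (β : ℝ) : ℝ :=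
  Real.exp (2 * π * β * ‖x‖) *
    ((1 + 2 * π * ‖x‖) * (k * (C * Real.exp (γ * β))) * fourierMajorant ρ β ψ +
      (k * (C * Real.exp (γ * (β + 1)))) ^ 2 * ‖L ν‖ * fourierMajorant ρ β ψ +
      k * (C * Real.exp (γ * β)) * fourierMajorant ρ β (innerWeight ψ ν))

/-- `0 ≤ K_β` for `β ≥ 0`, `C ≥ 0`. [folklore] -/
theorem phiMajorant_nonneg (L : V →L[ℝ] 𝕄) {C γ ρ : ℝ} (hC : 0 ≤ C) (ψ : V → Fin k → ℂ)
    (x ν : V) {β : ℝ} (hβ : 0 ≤ β) : 0 ≤ phiMajorant L C γ ρ ψ x ν β := by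
  unfold phiMajorant
  have h1 := fourierMajorant_nonneg (ρ := ρ) hβ ψ
  have h2 := fourierMajorant_nonneg (ρ := ρ) hβ (innerWeight ψ ν)
  positivity

set_option maxHeartbeats 1000000 in
/-- **The three bounds.** For `|b| ≤ β` the integrand `Φ_b`, its `b`-derivative and its line
derivative along `ν` are all bounded by `K_β (1 + ‖ξ‖^D)⁻¹`. [folklore] -/
theorem norm_defPhi_le {L : V →L[ℝ] 𝕄} {C γ : ℝ} (hT : HasExpType L C γ) (hC : 0 ≤ C) (hγ : 0 ≤ γ)
    {ψ : V → Fin k → ℂ} (hψ : ContDiff ℝ ∞ ψ) (hc : HasCompactSupport ψ) {ρ : ℝ} (hρ : 0 ≤ ρ)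
    (hsupp : tsupport ψ ⊆ closedBall (0 : V) ρ) {x ν : V} (hν : ‖ν‖ ≤ 1) {β b : ℝ} (hb : |b| ≤ β)
    (ξ : V) :
    ‖defPhi L ψ x ν b ξ‖ ≤ phiMajorant L C γ ρ ψ x ν β * (1 + ‖ξ‖ ^ (Module.finrank ℝ V + 1))⁻¹ ∧
    ‖defPhiDb L ψ x ν b ξ‖ ≤ phiMajorant L C γ ρ ψ x ν β * (1 + ‖ξ‖ ^ (Module.finrank ℝ V + 1))⁻¹ ∧
    ‖defPhiDν L ψ x ν b ξ‖ ≤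
      phiMajorant L C γ ρ ψ x ν β * (1 + ‖ξ‖ ^ (Module.finrank ℝ V + 1))⁻¹ := by
  set D := Module.finrank ℝ V + 1 with hD
  set w : ℝ := (1 + ‖ξ‖ ^ D)⁻¹ with hw
  have hw0 : 0 ≤ w := by positivity
  have hβ : 0 ≤ β := (abs_nonneg b).trans hb
  -- the factors
  set e := ‖phaseE x ν b ξ‖ with he
  set m := ‖symM L ν b ξ‖ with hm
  set dm := ‖symD L ν b ξ‖ with hdm
  set q := ‖𝓕 (deform ψ ν b) ξ‖ with hq
  set dq := ‖𝓕 (deform (innerWeight ψ ν) ν b) ξ‖ with hdq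
  -- their bounds
  set Eβ := Real.exp (2 * π * β * ‖x‖) with hEβ
  set Mβ := (k : ℝ) * (C * Real.exp (γ * β)) with hMβ
  set DMβ := ((k : ℝ) * (C * Real.exp (γ * (β + 1)))) ^ 2 * ‖L ν‖ with hDMβ
  set Qβ := fourierMajorant ρ β ψ with hQβ
  set DQβ := fourierMajorant ρ β (innerWeight ψ ν) with hDQβ
  have he' : e ≤ Eβ := norm_phaseE_le hν hb ξ
  have hm' : m ≤ Mβ := by
    refine (hT.norm_symM_le hC hν b ξ).trans ?_
    rw [hMβ]
    exact mul_le_mul_of_nonneg_left (mul_le_mul_of_nonneg_left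
      (Real.exp_le_exp.2 (mul_le_mul_of_nonneg_left hb hγ)) hC) (Nat.cast_nonneg k)
  have hdm' : dm ≤ DMβ := by
    refine (hT.norm_symD_le hC hγ hν b ξ).trans ?_
    rw [hDMβ]
    refine mul_le_mul_of_nonneg_right (pow_le_pow_left₀ (by positivity) ?_ 2) (norm_nonneg _)
    exact mul_le_mul_of_nonneg_left (mul_le_mul_of_nonneg_left
      (Real.exp_le_exp.2 (mul_le_mul_of_nonneg_left (by linarith) hγ)) hC) (Nat.cast_nonneg k)
  have hq' : q ≤ Qβ * w := norm_fourier_deform_le_inv hψ hc hρ hsupp hν hb ξ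
  have hdq' : dq ≤ DQβ * w :=
    norm_fourier_deform_le_inv (contDiff_innerWeight hψ ν) (hasCompactSupport_innerWeight hc ν) hρ
      ((tsupport_innerWeight_subset ψ ν).trans hsupp) hν hb ξ
  have hQ0 : 0 ≤ Qβ := fourierMajorant_nonneg hβ ψ
  have hDQ0 : 0 ≤ DQβ := fourierMajorant_nonneg hβ (innerWeight ψ ν)
  have hx1 : ‖((2 * π * ⟪x, ν⟫ : ℝ) : ℂ)‖ ≤ 2 * π * ‖x‖ := by
    rw [Complex.norm_real, Real.norm_eq_abs, abs_mul, abs_of_pos Real.two_pi_pos]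
    refine mul_le_mul_of_nonneg_left ?_ Real.two_pi_pos.le
    calc |⟪x, ν⟫| ≤ ‖x‖ * ‖ν‖ := abs_real_inner_le_norm x ν
      _ ≤ ‖x‖ * 1 := mul_le_mul_of_nonneg_left hν (norm_nonneg _)
      _ = ‖x‖ := mul_one _
  have hx2 : ‖(2 * π * I * ⟪ν, x⟫ : ℂ)‖ ≤ 2 * π * ‖x‖ := by
    have : (2 * π * I * ⟪ν, x⟫ : ℂ) = ((2 * π * ⟪ν, x⟫ : ℝ) : ℂ) * I := by push_cast; ring
    rw [this, norm_mul, Complex.norm_I, mul_one, Complex.norm_real, Real.norm_eq_abs, abs_mul,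
      abs_of_pos Real.two_pi_pos]
    refine mul_le_mul_of_nonneg_left ?_ Real.two_pi_pos.le
    calc |⟪ν, x⟫| ≤ ‖ν‖ * ‖x‖ := abs_real_inner_le_norm ν x
      _ ≤ 1 * ‖x‖ := mul_le_mul_of_nonneg_right hν (norm_nonneg _)
      _ = ‖x‖ := one_mul _
  -- elementary products
  have hmul : ∀ {a a' c c' : ℝ}, 0 ≤ a → 0 ≤ c → a ≤ a' → c ≤ c' → a * c ≤ a' * c' :=
    fun ha hc haa hcc => mul_le_mul haa hcc hc (ha.trans haa)
  have hmq : ‖symM L ν b ξ *ᵥ 𝓕 (deform ψ ν b) ξ‖ ≤ Mβ * (Qβ * w) :=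
    (Matrix.linfty_opNorm_mulVec _ _).trans (hmul (norm_nonneg _) (norm_nonneg _) hm' hq')
  have hdmq : ‖symD L ν b ξ *ᵥ 𝓕 (deform ψ ν b) ξ‖ ≤ DMβ * (Qβ * w) :=
    (Matrix.linfty_opNorm_mulVec _ _).trans (hmul (norm_nonneg _) (norm_nonneg _) hdm' hq')
  have hmdq : ‖symM L ν b ξ *ᵥ 𝓕 (deform (innerWeight ψ ν) ν b) ξ‖ ≤ Mβ * (DQβ * w) :=
    (Matrix.linfty_opNorm_mulVec _ _).trans (hmul (norm_nonneg _) (norm_nonneg _) hm' hdq')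
  have hmdq' : ‖symM L ν b ξ *ᵥ 𝓕 (fun v => (-(2 * π * I * ⟪v, ν⟫)) • deform ψ ν b v) ξ‖ ≤
      Mβ * (DQβ * w) := by
    have heq : 𝓕 (fun v => (-(2 * π * I * ⟪v, ν⟫)) • deform ψ ν b v) ξ =
        (-I) • 𝓕 (deform (innerWeight ψ ν) ν b) ξ := by
      rw [fourier_deform_innerWeight_eq, smul_smul, show -I * I = 1 by rw [neg_mul, I_mul_I, neg_neg],
        one_smul]
    rw [heq, Matrix.mulVec_smul, norm_smul, norm_neg, Complex.norm_I, one_mul]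
    exact hmdq
  have hE0 : 0 ≤ Eβ := (Real.exp_pos _).le
  have hM0 : 0 ≤ Mβ := by rw [hMβ]; positivity
  -- the majorant, expanded
  have hK : phiMajorant L C γ ρ ψ x ν β = Eβ * ((1 + 2 * π * ‖x‖) * Mβ * Qβ + DMβ * Qβ + Mβ * DQβ) := by
    simp only [phiMajorant, hEβ, hMβ, hDMβ, hQβ, hDQβ]
  refine ⟨?_, ?_, ?_⟩
  · -- `Φ`
    rw [defPhi, norm_smul, hK]
    calc e * ‖symM L ν b ξ *ᵥ 𝓕 (deform ψ ν b) ξ‖ ≤ Eβ * (Mβ * (Qβ * w)) :=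
          hmul (norm_nonneg _) (norm_nonneg _) he' hmq
      _ = Eβ * (1 * Mβ * Qβ) * w := by ring
      _ ≤ Eβ * ((1 + 2 * π * ‖x‖) * Mβ * Qβ + DMβ * Qβ + Mβ * DQβ) * w := by
          refine mul_le_mul_of_nonneg_right (mul_le_mul_of_nonneg_left ?_ hE0) hw0
          have h1 : (1 : ℝ) * Mβ * Qβ ≤ (1 + 2 * π * ‖x‖) * Mβ * Qβ := by
            gcongr; linarith [show 0 ≤ 2 * π * ‖x‖ by positivity]
          have h2 : 0 ≤ DMβ * Qβ := by positivity
          have h3 : 0 ≤ Mβ * DQβ := by positivity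
          linarith
  · -- `∂_b Φ`
    rw [defPhiDb, hK]
    refine (norm_add_le _ _).trans ?_
    rw [norm_smul, norm_mul]
    have t1 : ‖((-(2 * π * ⟪x, ν⟫) : ℂ))‖ * e * ‖symM L ν b ξ *ᵥ 𝓕 (deform ψ ν b) ξ‖ ≤
        (2 * π * ‖x‖) * Eβ * (Mβ * (Qβ * w)) := by
      refine hmul (by positivity) (norm_nonneg _) (hmul (norm_nonneg _) (norm_nonneg _) ?_ he') hmq
      rw [norm_neg]
      exact_mod_cast hx1
    have t2 : ‖phaseE x ν b ξ • ((I • symD L ν b ξ) *ᵥ 𝓕 (deform ψ ν b) ξ +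
        symM L ν b ξ *ᵥ 𝓕 (deform (innerWeight ψ ν) ν b) ξ)‖ ≤
        Eβ * (DMβ * (Qβ * w) + Mβ * (DQβ * w)) := by
      rw [norm_smul]
      refine hmul (norm_nonneg _) (norm_nonneg _) he' ((norm_add_le _ _).trans (add_le_add ?_ hmdq))
      rw [Matrix.smul_mulVec, norm_smul, Complex.norm_I, one_mul]
      exact hdmq
    calc _ ≤ (2 * π * ‖x‖) * Eβ * (Mβ * (Qβ * w)) + Eβ * (DMβ * (Qβ * w) + Mβ * (DQβ * w)) :=
          add_le_add t1 t2
      _ = Eβ * ((2 * π * ‖x‖) * Mβ * Qβ + DMβ * Qβ + Mβ * DQβ) * w := by ring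
      _ ≤ Eβ * ((1 + 2 * π * ‖x‖) * Mβ * Qβ + DMβ * Qβ + Mβ * DQβ) * w := by
          refine mul_le_mul_of_nonneg_right (mul_le_mul_of_nonneg_left ?_ hE0) hw0
          have : (2 * π * ‖x‖) * Mβ * Qβ ≤ (1 + 2 * π * ‖x‖) * Mβ * Qβ := by
            gcongr; linarith
          linarith
  · -- `∂_ν Φ`
    rw [defPhiDν, hK]
    refine (norm_add_le _ _).trans ?_
    rw [norm_smul, norm_mul]
    have t1 : ‖(2 * π * I * ⟪ν, x⟫ : ℂ)‖ * e * ‖symM L ν b ξ *ᵥ 𝓕 (deform ψ ν b) ξ‖ ≤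
        (2 * π * ‖x‖) * Eβ * (Mβ * (Qβ * w)) :=
      hmul (by positivity) (norm_nonneg _) (hmul (norm_nonneg _) (norm_nonneg _) hx2 he') hmq
    have t2 : ‖phaseE x ν b ξ • (symD L ν b ξ *ᵥ 𝓕 (deform ψ ν b) ξ +
        symM L ν b ξ *ᵥ 𝓕 (fun v => (-(2 * π * I * ⟪v, ν⟫)) • deform ψ ν b v) ξ)‖ ≤
        Eβ * (DMβ * (Qβ * w) + Mβ * (DQβ * w)) := by
      rw [norm_smul]
      exact hmul (norm_nonneg _) (norm_nonneg _) he'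
        ((norm_add_le _ _).trans (add_le_add hdmq hmdq'))
    calc _ ≤ (2 * π * ‖x‖) * Eβ * (Mβ * (Qβ * w)) + Eβ * (DMβ * (Qβ * w) + Mβ * (DQβ * w)) :=
          add_le_add t1 t2
      _ = Eβ * ((2 * π * ‖x‖) * Mβ * Qβ + DMβ * Qβ + Mβ * DQβ) * w := by ring
      _ ≤ Eβ * ((1 + 2 * π * ‖x‖) * Mβ * Qβ + DMβ * Qβ + Mβ * DQβ) * w := by
          refine mul_le_mul_of_nonneg_right (mul_le_mul_of_nonneg_left ?_ hE0) hw0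
          have : (2 * π * ‖x‖) * Mβ * Qβ ≤ (1 + 2 * π * ‖x‖) * Mβ * Qβ := by
            gcongr; linarith
          linarith

end Majorant

/-! ### The deformed integral `J(b) = ∫ Φ_b` -/

section Deformation

/-- Continuity of `ξ ↦ 𝓕χ_b(ξ)` for `χ ∈ C_c^∞`. [folklore] -/
theorem continuous_fourier_deform {χ : V → Fin k → ℂ} (hχ : ContDiff ℝ ∞ χ)
    (hcχ : HasCompactSupport χ) (ν : V) (b : ℝ) : Continuous (𝓕 (deform χ ν b)) := by
  have hcont : Continuous (deform χ ν b) := (contDiff_deform hχ ν b).continuous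
  have hcs : HasCompactSupport (deform χ ν b) := hasCompactSupport_deform hcχ ν b
  refine (Real.contDiff_fourier (N := 0) fun n hn => ?_).continuous
  have hn0 : n = 0 := by exact_mod_cast nonpos_iff_eq_zero.1 hn
  subst hn0
  have h : Integrable (fun v => ‖deform χ ν b v‖) (volume : Measure V) :=
    hcont.norm.integrable_of_hasCompactSupport hcs.norm
  simpa using h

/-- Continuity of `ξ ↦ Φ_b(ξ)`. [folklore] -/
theorem continuous_defPhi (L : V →L[ℝ] 𝕄) {ψ : V → Fin k → ℂ} (hψ : ContDiff ℝ ∞ ψ)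
    (hc : HasCompactSupport ψ) (x ν : V) (b : ℝ) : Continuous (defPhi L ψ x ν b) := by
  unfold defPhi phaseE symM
  have h1 : Continuous fun ξ : V => Complex.exp (((2 * π * ⟪ξ, x⟫ : ℝ) : ℂ) * I) *
      ((Real.exp (-(2 * π * b * ⟪x, ν⟫)) : ℝ) : ℂ) :=
    ((Complex.continuous_exp.comp ((Complex.continuous_ofReal.comp
      (continuous_const.mul (continuous_id.inner continuous_const))).mul continuous_const))).mul
      continuous_const
  have h2 : Continuous fun ξ : V => NormedSpace.exp (L ξ + ((b : ℂ) * I) • L ν) :=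
    NormedSpace.exp_continuous.comp (L.continuous.add continuous_const)
  have h3 := continuous_fourier_deform hψ hc ν b
  exact h1.smul (((mulVecBilin (k := k)).continuous₂).comp (h2.prodMk h3))

/-- `J(b) = ∫ Φ_b(ξ) dξ`. [folklore] -/
def defJ (L : V →L[ℝ] 𝕄) (ψ : V → Fin k → ℂ) (x ν : V) (b : ℝ) : Fin k → ℂ :=
  ∫ ξ, defPhi L ψ x ν b ξ

/-- The majorant `K_β (1 + ‖ξ‖^D)⁻¹` is integrable. [folklore] -/
theorem integrable_majorant (K : ℝ) :
    Integrable fun ξ : V => K * (1 + ‖ξ‖ ^ (Module.finrank ℝ V + 1))⁻¹ :=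
  (integrable_inv_one_add_norm_pow (V := V) (D := Module.finrank ℝ V + 1)
    (Nat.lt_succ_self _)).const_mul K

/-- `Φ_b` is integrable. [folklore] -/
theorem integrable_defPhi (L : V →L[ℝ] 𝕄) {C γ : ℝ} (hT : HasExpType L C γ) (hC : 0 ≤ C) (hγ : 0 ≤ γ)
    {ψ : V → Fin k → ℂ} (hψ : ContDiff ℝ ∞ ψ) (hc : HasCompactSupport ψ) {ρ : ℝ} (hρ : 0 ≤ ρ)
    (hsupp : tsupport ψ ⊆ closedBall (0 : V) ρ) (x : V) {ν : V} (hν : ‖ν‖ ≤ 1) (b : ℝ) :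
    Integrable (defPhi L ψ x ν b) := by
  have h1 := integrable_majorant (V := V) (phiMajorant L C γ ρ ψ x ν |b|)
  have h2 : AEStronglyMeasurable (defPhi L ψ x ν b) volume :=
    (continuous_defPhi L hψ hc x ν b).aestronglyMeasurable
  refine h1.mono' h2 (Eventually.of_forall fun ξ => ?_)
  exact (norm_defPhi_le hT hC hγ hψ hc hρ hsupp hν le_rfl ξ).1

/-- `∂_νΦ_b` is integrable. [folklore] -/
theorem integrable_defPhiDν (L : V →L[ℝ] 𝕄) {C γ : ℝ} (hT : HasExpType L C γ) (hC : 0 ≤ C) (hγ : 0 ≤ γ)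
    {ψ : V → Fin k → ℂ} (hψ : ContDiff ℝ ∞ ψ) (hc : HasCompactSupport ψ) {ρ : ℝ} (hρ : 0 ≤ ρ)
    (hsupp : tsupport ψ ⊆ closedBall (0 : V) ρ) (x : V) {ν : V} (hν : ‖ν‖ ≤ 1) (b : ℝ) :
    Integrable (defPhiDν L ψ x ν b) := by
  refine (integrable_majorant _).mono' ?_
    (Eventually.of_forall fun ξ => (norm_defPhi_le hT hC hγ hψ hc hρ hsupp hν le_rfl ξ).2.2)
  -- measurability: `∂_νΦ_b` is the line derivative of the continuous `Φ_b`
  refine (aestronglyMeasurable_lineDeriv (𝕜 := ℝ) (v := ν) (μ := volume)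
    (continuous_defPhi L hψ hc x ν b)).congr (ae_of_all _ fun ξ => ?_)
  exact (hasLineDerivAt_defPhi L hψ hc x ν ξ b).lineDeriv

/-- `∂_bΦ_b` is a.e.-strongly measurable in `ξ` (it is `i ∂_νΦ_b`). [folklore] -/
theorem aestronglyMeasurable_defPhiDb (L : V →L[ℝ] 𝕄) {ψ : V → Fin k → ℂ} (hψ : ContDiff ℝ ∞ ψ)
    (hc : HasCompactSupport ψ) (x ν : V) (b : ℝ) : AEStronglyMeasurable (defPhiDb L ψ x ν b) volume := by
  have h : AEStronglyMeasurable (defPhiDν L ψ x ν b) volume := by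
    refine (aestronglyMeasurable_lineDeriv (𝕜 := ℝ) (v := ν) (μ := volume)
      (continuous_defPhi L hψ hc x ν b)).congr (ae_of_all _ fun ξ => ?_)
    exact (hasLineDerivAt_defPhi L hψ hc x ν ξ b).lineDeriv
  have hfun : defPhiDb L ψ x ν b = fun ξ => I • defPhiDν L ψ x ν b ξ :=
    funext fun ξ => defPhiDb_eq L ψ x ν ξ b
  rw [hfun]
  exact h.const_smul I

/-- **`J` is differentiable with `J'(b) = ∫ ∂_bΦ_b`** (differentiation under the integral sign,
dominated by the majorant on `|b| ≤ |b₀| + 1`). [folklore] -/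
theorem hasDerivAt_defJ (L : V →L[ℝ] 𝕄) {C γ : ℝ} (hT : HasExpType L C γ) (hC : 0 ≤ C) (hγ : 0 ≤ γ)
    {ψ : V → Fin k → ℂ} (hψ : ContDiff ℝ ∞ ψ) (hc : HasCompactSupport ψ) {ρ : ℝ} (hρ : 0 ≤ ρ)
    (hsupp : tsupport ψ ⊆ closedBall (0 : V) ρ) (x : V) {ν : V} (hν : ‖ν‖ ≤ 1) (b₀ : ℝ) :
    HasDerivAt (defJ L ψ x ν) (∫ ξ, defPhiDb L ψ x ν b₀ ξ) b₀ := by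
  have hball : ∀ b ∈ ball b₀ 1, |b| ≤ |b₀| + 1 := fun b hb => by
    have : |b - b₀| < 1 := by simpa [Real.dist_eq] using mem_ball.1 hb
    have := abs_sub_abs_le_abs_sub b b₀
    linarith
  have key := hasDerivAt_integral_of_dominated_loc_of_deriv_le (μ := (volume : Measure V))
    (F := fun b ξ => defPhi L ψ x ν b ξ) (F' := fun b ξ => defPhiDb L ψ x ν b ξ) (x₀ := b₀)
    (s := ball b₀ 1) (ball_mem_nhds b₀ one_pos)
    (Eventually.of_forall fun b => (continuous_defPhi L hψ hc x ν b).aestronglyMeasurable)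
    (integrable_defPhi L hT hC hγ hψ hc hρ hsupp x hν b₀)
    (aestronglyMeasurable_defPhiDb L hψ hc x ν b₀)
    (Eventually.of_forall fun ξ b hb =>
      (norm_defPhi_le hT hC hγ hψ hc hρ hsupp hν (hball b hb) ξ).2.1)
    (integrable_majorant _)
    (Eventually.of_forall fun ξ b _ => hasDerivAt_defPhi_param L hψ hc x ν ξ b)
  exact key.2

/-- **`∫ ∂_νΦ_b = 0`** (no boundary terms: integration by parts against the constant `1`).
[folklore] -/
theorem integral_defPhiDν_eq_zero (L : V →L[ℝ] 𝕄) {C γ : ℝ} (hT : HasExpType L C γ) (hC : 0 ≤ C) (hγ : 0 ≤ γ)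
    {ψ : V → Fin k → ℂ} (hψ : ContDiff ℝ ∞ ψ) (hc : HasCompactSupport ψ) {ρ : ℝ} (hρ : 0 ≤ ρ)
    (hsupp : tsupport ψ ⊆ closedBall (0 : V) ρ) (x : V) {ν : V} (hν : ‖ν‖ ≤ 1) (b : ℝ) :
    ∫ ξ, defPhiDν L ψ x ν b ξ = 0 := by
  set B : (Fin k → ℂ) →L[ℝ] ℂ →L[ℝ] (Fin k → ℂ) := (ContinuousLinearMap.lsmul ℝ ℂ).flip with hB
  have hBapply : ∀ (u : Fin k → ℂ) (c : ℂ), B u c = c • u := fun u c => rfl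
  have hf := integrable_defPhi L hT hC hγ hψ hc hρ hsupp x hν b
  have hf' := integrable_defPhiDν L hT hC hγ hψ hc hρ hsupp x hν b
  have h := integral_bilinear_hasLineDerivAt_right_eq_neg_left_of_integrable (μ := (volume : Measure V))
    (f := defPhi L ψ x ν b) (f' := defPhiDν L ψ x ν b) (g := fun _ : V => (1 : ℂ))
    (g' := fun _ => (0 : ℂ)) (v := ν) (B := B) ?_ ?_ ?_ ?_ ?_
  · simpa [hBapply] using h
  · simpa [hBapply] using hf'
  · simp [hBapply]
  · simpa [hBapply] using hf
  · intro ξ _; exact hasLineDerivAt_defPhi L hψ hc x ν ξ b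
  · intro ξ _; exact hasDerivAt_const (0 : ℝ) (1 : ℂ)

/-- **`J` is constant**: `J(b) = J(0)`. [folklore] -/
theorem defJ_eq_defJ_zero (L : V →L[ℝ] 𝕄) {C γ : ℝ} (hT : HasExpType L C γ) (hC : 0 ≤ C) (hγ : 0 ≤ γ)
    {ψ : V → Fin k → ℂ} (hψ : ContDiff ℝ ∞ ψ) (hc : HasCompactSupport ψ) {ρ : ℝ} (hρ : 0 ≤ ρ)
    (hsupp : tsupport ψ ⊆ closedBall (0 : V) ρ) (x : V) {ν : V} (hν : ‖ν‖ ≤ 1) (b : ℝ) :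
    defJ L ψ x ν b = defJ L ψ x ν 0 := by
  have hzero : ∀ b₀, HasDerivAt (defJ L ψ x ν) 0 b₀ := by
    intro b₀
    have h := hasDerivAt_defJ L hT hC hγ hψ hc hρ hsupp x hν b₀
    have hint : ∫ ξ, defPhiDb L ψ x ν b₀ ξ = 0 := by
      have hfun : defPhiDb L ψ x ν b₀ = fun ξ => I • defPhiDν L ψ x ν b₀ ξ :=
        funext fun ξ => defPhiDb_eq L ψ x ν ξ b₀
      rw [hfun, integral_smul, integral_defPhiDν_eq_zero L hT hC hγ hψ hc hρ hsupp x hν b₀, smul_zero]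
    rwa [hint] at h
  exact is_const_of_deriv_eq_zero (fun b₀ => (hzero b₀).differentiableAt)
    (fun b₀ => (hzero b₀).deriv) b 0

/-- **Exponential decay of the integrand in `b`**:
`‖J(b)‖ ≤ e^{-2πb⟪x,ν⟫} · kC e^{γ|b|} · (1 + 4^D(D+1)) (1 + 2π|b|)^D e^{2πρ|b|} (Σ∫‖Dʲψ‖) I_D`.
[folklore] -/
theorem norm_defJ_le (L : V →L[ℝ] 𝕄) {C γ : ℝ} (hT : HasExpType L C γ) (hC : 0 ≤ C)
    {ψ : V → Fin k → ℂ} (hψ : ContDiff ℝ ∞ ψ) (hc : HasCompactSupport ψ) {ρ : ℝ}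
    (hsupp : tsupport ψ ⊆ closedBall (0 : V) ρ) (x : V) {ν : V} (hν : ‖ν‖ ≤ 1) (b : ℝ) :
    ‖defJ L ψ x ν b‖ ≤
      Real.exp (-(2 * π * b * ⟪x, ν⟫)) * (k * (C * Real.exp (γ * |b|))) *
        ((1 + 4 ^ (Module.finrank ℝ V + 1) * ((Module.finrank ℝ V + 1 : ℕ) + 1)) *
          (1 + 2 * π * |b|) ^ (Module.finrank ℝ V + 1) * Real.exp (2 * π * ρ * |b|) *
          derivIntSum (Module.finrank ℝ V + 1) ψ *
          ∫ w : V, (1 + ‖w‖ ^ (Module.finrank ℝ V + 1))⁻¹) := by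
  set c : ℝ := Real.exp (-(2 * π * b * ⟪x, ν⟫)) * (k * (C * Real.exp (γ * |b|))) with hcdef
  have hc0 : 0 ≤ c := by positivity
  -- pointwise bound `‖Φ_b(ξ)‖ ≤ c ‖𝓕ψ_b(ξ)‖`
  have hpt : ∀ ξ, ‖defPhi L ψ x ν b ξ‖ ≤ c * ‖𝓕 (deform ψ ν b) ξ‖ := by
    intro ξ
    rw [defPhi, norm_smul, norm_phaseE, hcdef]
    have h1 : ‖symM L ν b ξ *ᵥ 𝓕 (deform ψ ν b) ξ‖ ≤
        (k * (C * Real.exp (γ * |b|))) * ‖𝓕 (deform ψ ν b) ξ‖ :=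
      (Matrix.linfty_opNorm_mulVec _ _).trans
        (mul_le_mul_of_nonneg_right (hT.norm_symM_le hC hν b ξ) (norm_nonneg _))
    calc Real.exp (-(2 * π * b * ⟪x, ν⟫)) * ‖symM L ν b ξ *ᵥ 𝓕 (deform ψ ν b) ξ‖
        ≤ Real.exp (-(2 * π * b * ⟪x, ν⟫)) * ((k * (C * Real.exp (γ * |b|))) *
            ‖𝓕 (deform ψ ν b) ξ‖) := mul_le_mul_of_nonneg_left h1 (Real.exp_pos _).le
      _ = _ := (mul_assoc _ _ _).symm
  -- integrability of `‖𝓕ψ_b‖` from the decay bound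
  have hdec : ∀ ξ, ‖𝓕 (deform ψ ν b) ξ‖ ≤
      fourierMajorant ρ |b| ψ * (1 + ‖ξ‖ ^ (Module.finrank ℝ V + 1))⁻¹ := fun ξ => by
    rcases le_or_gt 0 ρ with hρ | hρ
    · exact norm_fourier_deform_le_inv hψ hc hρ hsupp hν le_rfl ξ
    · -- `ρ < 0`: the support is empty, `ψ = 0`
      have hψ0 : deform ψ ν b = 0 := by
        funext y
        have : y ∉ tsupport ψ := fun hy => by
          have := hsupp hy
          rw [mem_closedBall, dist_zero_right] at this
          linarith [norm_nonneg y]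
        simp [deform, image_eq_zero_of_notMem_tsupport this]
      rw [hψ0]
      have : 𝓕 (0 : V → Fin k → ℂ) ξ = 0 := by simp [Real.fourier_eq, Circle.smul_def]
      rw [this, norm_zero]
      exact mul_nonneg (fourierMajorant_nonneg (abs_nonneg b) ψ) (by positivity)
  have hint : Integrable fun ξ => ‖𝓕 (deform ψ ν b) ξ‖ :=
    (integrable_majorant _).mono' (continuous_fourier_deform hψ hc ν b).norm.aestronglyMeasurable
      (Eventually.of_forall fun ξ => by rw [Real.norm_of_nonneg (norm_nonneg _)]; exact hdec ξ)
  calc ‖defJ L ψ x ν b‖ ≤ ∫ ξ, ‖defPhi L ψ x ν b ξ‖ := norm_integral_le_integral_norm _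
    _ ≤ ∫ ξ, c * ‖𝓕 (deform ψ ν b) ξ‖ :=
        integral_mono_of_nonneg (Eventually.of_forall fun ξ => norm_nonneg _) (hint.const_mul c)
          (Eventually.of_forall hpt)
    _ = c * ∫ ξ, ‖𝓕 (deform ψ ν b) ξ‖ := integral_const_mul _ _
    _ ≤ c * _ := mul_le_mul_of_nonneg_left (integral_norm_fourier_deform_le hψ hc hsupp hν b) hc0

/-- `(1 + 2πb)^D e^{-δb} → 0` as `b → ∞`, for `δ > 0`. [folklore] -/
theorem tendsto_pow_mul_exp_neg_mul {δ : ℝ} (hδ : 0 < δ) (D : ℕ) :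
    Tendsto (fun b : ℝ => (1 + 2 * π * b) ^ D * Real.exp (-(δ * b))) atTop (𝓝 0) := by
  -- `u = (δ/2π)(1 + 2πb) → ∞` and `(1+2πb)^D e^{-δb} = (2π/δ)^D e^{δ/2π} u^D e^{-u}`
  have h2π : 0 < 2 * π := Real.two_pi_pos
  set a : ℝ := δ / (2 * π) with ha
  have ha0 : 0 < a := div_pos hδ h2π
  have hu : Tendsto (fun b : ℝ => a * (1 + 2 * π * b)) atTop atTop := by
    refine Tendsto.const_mul_atTop ha0 ?_
    refine tendsto_atTop_add_const_left _ 1 ?_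
    exact Tendsto.const_mul_atTop h2π tendsto_id
  have hlim := (tendsto_pow_mul_exp_neg_atTop_nhds_zero D).comp hu
  have hfun : (fun b : ℝ => (1 + 2 * π * b) ^ D * Real.exp (-(δ * b))) =
      fun b => (a⁻¹) ^ D * Real.exp a * ((fun x : ℝ => x ^ D * Real.exp (-x)) ∘
        fun b : ℝ => a * (1 + 2 * π * b)) b := by
    funext b
    simp only [Function.comp_apply]
    rw [mul_pow, show -(a * (1 + 2 * π * b)) = -a + -(δ * b) by rw [ha]; field_simp; ring,
      Real.exp_add]
    have : (a⁻¹) ^ D * a ^ D = 1 := by rw [← mul_pow, inv_mul_cancel₀ ha0.ne', one_pow]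
    have hexp : Real.exp a * Real.exp (-a) = 1 := by rw [← Real.exp_add, add_neg_cancel, Real.exp_zero]
    calc (1 + 2 * π * b) ^ D * Real.exp (-(δ * b))
        = ((a⁻¹) ^ D * a ^ D) * (Real.exp a * Real.exp (-a)) *
            ((1 + 2 * π * b) ^ D * Real.exp (-(δ * b))) := by rw [this, hexp, one_mul, one_mul]
      _ = _ := by ring
  rw [hfun]
  simpa using hlim.const_mul ((a⁻¹) ^ D * Real.exp a)

/-- **Paley–Wiener by deformation (support of multiplier outputs for symbols of exponential
type).** Let `L : V →L[ℝ] 𝕄` and suppose the deformed symbols `exp(Lξ + (ib)Lν)` are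
entrywise bounded by `C e^{γ|b|}` for all frequencies `ξ`, unit directions `ν` and real `b`.
Then for every `ψ ∈ C_c^∞(V; ℂᵏ)` supported in `B̄(0, ρ)`, the multiplier output
`exp(L·)(D)ψ = 𝓕⁻¹[exp(Lξ) 𝓕ψ(ξ)]` vanishes at every `x` with `‖x‖ > ρ + γ/(2π)`.
(Proof: `J(b) = ∫ E_b M_b 𝓕ψ_b` is independent of `b` by Cauchy–Riemann and integration by
parts, equals the output at `b = 0`, and tends to `0` as `b → +∞` along `ν = x/‖x‖`.)
[folklore] -/
theorem multiplierOp_exp_apply_eq_zero {L : V →L[ℝ] 𝕄} {C γ : ℝ} (hT : HasExpType L C γ)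
    (hC : 0 ≤ C) (hγ : 0 ≤ γ) {ψ : V → Fin k → ℂ} (hψ : ContDiff ℝ ∞ ψ)
    (hc : HasCompactSupport ψ) {ρ : ℝ} (hρ : 0 ≤ ρ) (hsupp : tsupport ψ ⊆ closedBall (0 : V) ρ)
    {x : V} (hx : ρ + γ / (2 * π) < ‖x‖) :
    multiplierOp (fun ξ => NormedSpace.exp (L ξ)) ψ x = 0 := by
  have h2π : 0 < 2 * π := Real.two_pi_pos
  have hxpos : 0 < ‖x‖ := lt_of_le_of_lt (by positivity) hx
  -- the direction
  set ν : V := ‖x‖⁻¹ • x with hν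
  have hνn : ‖ν‖ = 1 := by
    rw [hν, norm_smul, norm_inv, norm_norm, inv_mul_cancel₀ hxpos.ne']
  have hν1 : ‖ν‖ ≤ 1 := hνn.le
  have hxν : ⟪x, ν⟫ = ‖x‖ := by
    rw [hν, real_inner_smul_right, real_inner_self_eq_norm_sq]
    field_simp
  -- `J(0)` is the multiplier output at `x`
  have hJ0 : defJ L ψ x ν 0 = multiplierOp (fun ξ => NormedSpace.exp (L ξ)) ψ x := by
    rw [defJ, multiplierOp_apply, Real.fourierInv_eq']
    refine integral_congr_ae (Eventually.of_forall fun ξ => ?_)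
    exact defPhi_zero L ψ x ν ξ
  rw [← hJ0]
  -- the decay rate
  set δ : ℝ := 2 * π * ‖x‖ - γ - 2 * π * ρ with hδ
  have hδ0 : 0 < δ := by
    have : γ / (2 * π) * (2 * π) = γ := div_mul_cancel₀ γ h2π.ne'
    nlinarith
  -- the constant in front
  set D := Module.finrank ℝ V + 1 with hD
  set A : ℝ := (k * C) * ((1 + 4 ^ D * ((D : ℕ) + 1 : ℝ)) * derivIntSum D ψ *
    ∫ w : V, (1 + ‖w‖ ^ D)⁻¹) with hA
  -- `‖J(0)‖ ≤ A (1 + 2πb)^D e^{-δ b}` for `b ≥ 0`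
  have hbound : ∀ b : ℝ, 0 ≤ b →
      ‖defJ L ψ x ν 0‖ ≤ A * ((1 + 2 * π * b) ^ D * Real.exp (-(δ * b))) := by
    intro b hb
    rw [← defJ_eq_defJ_zero L hT hC hγ hψ hc hρ hsupp x hν1 b]
    refine (norm_defJ_le L hT hC hψ hc hsupp x hν1 b).trans (le_of_eq ?_)
    rw [abs_of_nonneg hb, hxν]
    have hexp : Real.exp (-(2 * π * b * ‖x‖)) * Real.exp (γ * b) * Real.exp (2 * π * ρ * b) =
        Real.exp (-(δ * b)) := by
      rw [← Real.exp_add, ← Real.exp_add, hδ]; congr 1; ring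
    rw [← hexp, hA]
    ring
  -- let `b → +∞`
  have hlim : Tendsto (fun b : ℝ => A * ((1 + 2 * π * b) ^ D * Real.exp (-(δ * b)))) atTop
      (𝓝 0) := by
    simpa using (tendsto_pow_mul_exp_neg_mul hδ0 D).const_mul A
  have hle : ‖defJ L ψ x ν 0‖ ≤ 0 :=
    le_of_tendsto_of_tendsto tendsto_const_nhds hlim
      ((Filter.eventually_ge_atTop (0 : ℝ)).mono fun b hb => hbound b hb)
  exact norm_le_zero_iff.1 hle

/-- **Translation covariance of multiplier operators**: `M(D)(f(· + v₀))(x) = M(D)f(x + v₀)`.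
[folklore] -/
theorem multiplierOp_comp_add_right (M : V → Matrix (Fin k) (Fin k) ℂ) (f : V → Fin k → ℂ)
    (v₀ x : V) :
    multiplierOp M (f ∘ fun v => v + v₀) x = multiplierOp M f (x + v₀) := by
  rw [multiplierOp_apply, multiplierOp_apply, Real.fourierInv_eq, Real.fourierInv_eq]
  have hshift : ∀ ξ : V, 𝓕 (f ∘ fun v => v + v₀) ξ = (𝐞 ⟪v₀, ξ⟫ : Circle) • 𝓕 f ξ := by
    intro ξ
    have := VectorFourier.fourierIntegral_comp_add_right 𝐞 (volume : Measure V) (innerₗ V) f v₀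
    exact congrFun this ξ
  refine integral_congr_ae (Eventually.of_forall fun ξ => ?_)
  simp only
  rw [hshift, Circle.smul_def, Circle.smul_def, Circle.smul_def, Matrix.mulVec_smul, smul_smul,
    ← Circle.coe_mul, ← AddChar.map_add_eq_mul, inner_add_right, real_inner_comm v₀ ξ]

omit [InnerProductSpace ℝ V] [FiniteDimensional ℝ V] [MeasurableSpace V] [BorelSpace V] in
/-- Support of a translate. [folklore] -/
theorem tsupport_comp_add_subset {ψ : V → Fin k → ℂ} {x₀ : V} {r : ℝ}
    (hsupp : tsupport ψ ⊆ closedBall x₀ r) :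
    tsupport (ψ ∘ fun v => v + x₀) ⊆ closedBall (0 : V) r := by
  refine closure_minimal (fun y hy => ?_) isClosed_closedBall
  have hy' : ψ (y + x₀) ≠ 0 := hy
  have hmem : y + x₀ ∈ closedBall x₀ r := hsupp (subset_tsupport _ hy')
  rw [mem_closedBall, dist_eq_norm, add_sub_cancel_right] at hmem
  rwa [mem_closedBall, dist_zero_right]

/-- **Paley–Wiener by deformation, general centre**: if `ψ` is supported in `B̄(x₀, r)` then
`exp(L·)(D)ψ` vanishes at every `x` with `‖x - x₀‖ > r + γ/(2π)`. [folklore] -/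
theorem multiplierOp_exp_apply_eq_zero_of_dist {L : V →L[ℝ] 𝕄} {C γ : ℝ}
    (hT : HasExpType L C γ) (hC : 0 ≤ C) (hγ : 0 ≤ γ) {ψ : V → Fin k → ℂ}
    (hψ : ContDiff ℝ ∞ ψ) (hc : HasCompactSupport ψ) {x₀ : V} {r : ℝ} (hr : 0 ≤ r)
    (hsupp : tsupport ψ ⊆ closedBall x₀ r) {x : V} (hx : r + γ / (2 * π) < ‖x - x₀‖) :
    multiplierOp (fun ξ => NormedSpace.exp (L ξ)) ψ x = 0 := by
  set ψ₀ : V → Fin k → ℂ := ψ ∘ fun v => v + x₀ with hψ₀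
  have hψ₀d : ContDiff ℝ ∞ ψ₀ := hψ.comp ((contDiff_id).add contDiff_const)
  have hψ₀c : HasCompactSupport ψ₀ := hc.comp_homeomorph (Homeomorph.addRight x₀)
  have hψ₀s : tsupport ψ₀ ⊆ closedBall (0 : V) r := tsupport_comp_add_subset hsupp
  have hback : ψ = ψ₀ ∘ fun v => v + (-x₀) := by
    funext v; simp [hψ₀]
  rw [hback, multiplierOp_comp_add_right, ← sub_eq_add_neg]
  exact multiplierOp_exp_apply_eq_zero hT hC hγ hψ₀d hψ₀c hr hψ₀s hx

end Deformation

end PartC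

end Literature.Analysis.Fourier

end
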